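import Literature.Topology.FourManifolds.FlipClean
import Literature.Topology.FourManifolds.BandLoopToEdge
import Literature.Topology.FourManifolds.BandSumNormalTransport
import HarnessLib

/-!
# The clean flip knot is the second summand: an edge loop of the partner datum

Topic `Literature/Topology/FourManifolds` (trunk T-4MAN). Fact seat
`provefact-Literature.Topology.FourManifolds.Knot.IsConnectedSum.isIsotopic` (Schubert's theorem),
geometric heart for rail knots, closure step for flip frames (second half). For a flip pair
`(b₁, b₂)` with `B₁ = R ∘ A₂`, the reflection of the clean knot of `FlipClean.lean` is a loop in the
band of `b₂` hanging off the left edge: reparametrised by the parameter of `A₂` it is an **edge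
loop** of `b₂` (`BandLoopToEdge.lean`), hence isotopic to `A₂`; so the clean knot, the frame knot of
the un-spiked flip frame, and the flip knots of `FlipWall.lean` are isotopic to `B₁`.

This first part: the calculus of the planar deep track needed for the monotonicity and turning
conditions (`deriv_deepTrack_one_nonneg`, `deepTrack_turn`).

Everything is proved; no named facts are introduced.

## References

* M. W. Hirsch, *Differential Topology*, Springer GTM 33 (1976), Ch. 8 §1. [HirschDT1976]
-/

open scoped Manifold ContDiff Topology Real
open Function Set Metric Filter

noncomputable section

namespace Literature.Topology.FourManifolds

/-- Local notation: `𝔼 n` is the model Euclidean space `EuclideanSpace ℝ (Fin n)`. -/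
local notation "𝔼 " n:arg => EuclideanSpace ℝ (Fin n)

/-- Local notation: `𝕊 n` is the unit sphere in `EuclideanSpace ℝ (Fin (n + 1))`. -/
local notation "𝕊 " n:arg => (Metric.sphere (0 : EuclideanSpace ℝ (Fin (n + 1))) 1)

attribute [local instance] fact_finrank_euclideanSpace_succ

open KnotsInBall

/-! ### Calculus of the turn profiles -/

/-- The first coordinate of the turn has nonnegative derivative everywhere. [folklore] -/
theorem deriv_turnX_nonneg (a : ℝ) : 0 ≤ deriv turnX a := by
  rcases lt_or_ge a 4 with h | h
  · exact (deriv_turnX_pos h).le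
  rcases h.eq_or_lt with h | h
  · rw [← h, (hasDerivAt_turnX 4).deriv, turnS_of_ge le_rfl]; norm_num
  · rw [deriv_turnX_of_gt h]

/-- The second coordinate of the turn has nonnegative derivative everywhere. [folklore] -/
theorem deriv_turnV_nonneg (a : ℝ) : 0 ≤ deriv turnV a :=
  monotone_turnV.deriv_nonneg

/-- Coordinates of the derivative of a planar path. [folklore] -/
theorem deriv_coord_eq {f : ℝ → 𝔼 2} {f' : 𝔼 2} {t : ℝ} (hf : HasDerivAt f f' t) (i : Fin 2) :
    deriv (fun t ↦ f t i) t = f' i := by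
  have := ((EuclideanSpace.proj i : 𝔼 2 →L[ℝ] ℝ).hasFDerivAt.comp_hasDerivAt t hf).deriv
  exact this

namespace BandData

section Track

variable {A B K : Knot} {avoid : Set (𝕊 3)} (b : BandData A B K avoid)
  {κ : ℝ} (hκ : 0 < κ) (h7 : 7 * κ ≤ b.gapLo) (h7' : 7 * κ ≤ b.gapHi)
include hκ

/-- **Derivative of the planar deep track on the lower zone** `t < parLo 5`. [folklore] -/
theorem hasDerivAt_deepTrack_lower {t : ℝ} (ht : t < b.parLo hκ h7 five_mem) :
    HasDerivAt (b.deepTrack hκ h7 h7')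
      (pt2 (deriv turnX (b.alphaLo κ t) * (deriv b.chiLo t / κ)) (deriv turnV (b.alphaLo κ t) * (deriv b.chiLo t / κ))) t := by
  have hev : b.deepTrack hκ h7 h7' =ᶠ[𝓝 t] fun t ↦ lowerTurn (b.alphaLo κ t) := by
    filter_upwards [Iio_mem_nhds ht] with s hs using b.deepTrack_of_le hκ h7 h7' (le_of_lt hs)
  refine HasDerivAt.congr_of_eventuallyEq ?_ hev
  have hα := b.hasDerivAt_alphaLo κ t
  have hX : HasDerivAt (fun t ↦ turnX (b.alphaLo κ t)) (deriv turnX (b.alphaLo κ t) * (deriv b.chiLo t / κ)) t :=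
    HasDerivAt.comp (h₂ := turnX) (h := b.alphaLo κ) t ((contDiff_turnX.differentiable (by simp)) _).hasDerivAt hα
  have hV : HasDerivAt (fun t ↦ turnV (b.alphaLo κ t)) (deriv turnV (b.alphaLo κ t) * (deriv b.chiLo t / κ)) t :=
    HasDerivAt.comp (h₂ := turnV) (h := b.alphaLo κ) t ((contDiff_turnV.differentiable (by simp)) _).hasDerivAt hα
  exact hasDerivAt_pt2 hX hV

/-- **Derivative of the planar deep track on the upper zone** `parHi 5 < t`. [folklore] -/
theorem hasDerivAt_deepTrack_upper {t : ℝ} (ht : b.parHi hκ h7' five_mem < t) :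
    HasDerivAt (b.deepTrack hκ h7 h7')
      (pt2 (deriv turnX (b.alphaHi κ t) * (deriv b.chiHi t / κ)) (-(deriv turnV (b.alphaHi κ t) * (deriv b.chiHi t / κ)))) t := by
  have hev : b.deepTrack hκ h7 h7' =ᶠ[𝓝 t] fun t ↦ upperTurn (b.alphaHi κ t) := by
    filter_upwards [Ioi_mem_nhds ht] with s hs using b.deepTrack_of_ge hκ h7 h7' (le_of_lt hs)
  refine HasDerivAt.congr_of_eventuallyEq ?_ hev
  have hα := b.hasDerivAt_alphaHi κ t
  have hX : HasDerivAt (fun t ↦ turnX (b.alphaHi κ t)) (deriv turnX (b.alphaHi κ t) * (deriv b.chiHi t / κ)) t :=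
    HasDerivAt.comp (h₂ := turnX) (h := b.alphaHi κ) t ((contDiff_turnX.differentiable (by simp)) _).hasDerivAt hα
  have hV : HasDerivAt (fun t ↦ -turnV (b.alphaHi κ t)) (-(deriv turnV (b.alphaHi κ t) * (deriv b.chiHi t / κ))) t :=
    (HasDerivAt.comp (h₂ := turnV) (h := b.alphaHi κ) t ((contDiff_turnV.differentiable (by simp)) _).hasDerivAt hα).neg
  exact hasDerivAt_pt2 hX hV

/-- **Derivative of the planar deep track on the tip zone** `(parLo (9/2), parHi (9/2))`. [folklore] -/
theorem hasDerivAt_deepTrack_tip {t : ℝ} (ht : t ∈ Ioo (b.parLo hκ h7 nine_halves_mem) (b.parHi hκ h7' nine_halves_mem)) :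
    HasDerivAt (b.deepTrack hκ h7 h7') (pt2 0 (deriv (b.tipClock hκ h7 h7') t)) t := by
  have hev : b.deepTrack hκ h7 h7' =ᶠ[𝓝 t] fun t ↦ pt2 4 (b.tipClock hκ h7 h7' t) := by
    filter_upwards [Ioo_mem_nhds ht.1 ht.2] with s hs
    rcases lt_or_ge s (b.parHi hκ h7' five_mem) with h | h
    · exact b.deepTrack_eq_tip_of_mem hκ h7 h7' ⟨hs.1.le, h⟩
    · have h5 : b.parLo hκ h7 five_mem < s := lt_of_lt_of_le (b.parLo_lt_parHi hκ h7 h7' five_mem five_mem) h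
      exact b.deepTrack_eq_tip_of_mem' hκ h7 h7' ⟨h5, hs.2.le⟩
  refine HasDerivAt.congr_of_eventuallyEq ?_ hev
  exact hasDerivAt_pt2 (hasDerivAt_const t 4) (((b.contDiff_tipClock hκ h7 h7').differentiable (by simp)) t).hasDerivAt

/-- The tip clock has positive derivative on the whole tip zone `(parLo (9/2), parHi (9/2))`.
[folklore] -/
theorem deriv_tipClock_pos_tipZone {t : ℝ} (ht : t ∈ Ioo (b.parLo hκ h7 nine_halves_mem) (b.parHi hκ h7' nine_halves_mem)) :
    0 < deriv (b.tipClock hκ h7 h7') t := by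
  rcases lt_or_ge t (b.parLo hκ h7 five_mem) with h5 | h5
  · -- left of `parLo 5`: `tipClock = -1 + (αLo - 15/4)/2`
    have hev : b.tipClock hκ h7 h7' =ᶠ[𝓝 t] fun t ↦ -1 + (b.alphaLo κ t - 15 / 4) / 2 := by
      filter_upwards [Iio_mem_nhds h5] with s hs using b.tipClock_of_le hκ h7 h7' (le_of_lt hs)
    rw [hev.deriv_eq]
    have hd : HasDerivAt (fun t ↦ -1 + (b.alphaLo κ t - 15 / 4) / 2) (((deriv b.chiLo t / κ) ) / 2) t := by
      have := (((b.hasDerivAt_alphaLo κ t).sub_const (15 / 4)).div_const 2).const_add (-1)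
      simpa using this
    rw [hd.deriv]
    have hc : t ∈ Icc (b.tcLo - b.epsLo / 8) (b.tcLo + b.epsLo / 8) :=
      b.mem_coreLo_of_zone hκ h7 ⟨(b.parLo_le_parLo hκ h7 neg_seven_mem nine_halves_mem (by norm_num)).trans ht.1.le, h5.le⟩
    exact div_pos (div_pos (b.deriv_chiLo_pos hc) hκ) two_pos
  rcases le_or_gt t (b.parHi hκ h7' five_mem) with h5' | h5'
  · exact b.deriv_tipClock_pos hκ h7 h7' ⟨h5, h5'⟩
  · have hev : b.tipClock hκ h7 h7' =ᶠ[𝓝 t] fun t ↦ 1 - (b.alphaHi κ t - 15 / 4) / 2 := by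
      filter_upwards [Ioi_mem_nhds h5'] with s hs using b.tipClock_of_ge hκ h7 h7' (le_of_lt hs)
    rw [hev.deriv_eq]
    have hd : HasDerivAt (fun t ↦ 1 - (b.alphaHi κ t - 15 / 4) / 2) (-(((deriv b.chiHi t / κ)) / 2)) t := by
      have := (((b.hasDerivAt_alphaHi κ t).sub_const (15 / 4)).div_const 2).const_sub 1
      simpa using this
    rw [hd.deriv]
    have hc : t ∈ Icc (b.tcHi - b.epsHi / 8) (b.tcHi + b.epsHi / 8) :=
      b.mem_coreHi_of_zone hκ h7' ⟨h5'.le, ht.2.le.trans (b.parHi_le_parHi hκ h7' neg_seven_mem nine_halves_mem (by norm_num))⟩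
    have := b.deriv_chiHi_neg hc
    have : deriv b.chiHi t / κ < 0 := div_neg_of_neg_of_pos this hκ
    linarith

/-- **THE PLANAR DEEP TRACK: MONOTONE SECOND COORDINATE AND THE TURNING INEQUALITY.** On
`[parLo (-7), parHi (-7)]`: `0 ≤ (deepTrack · 1)'`, `(deepTrack t 1) (deepTrack · 0)' ≤ 0`, and one of
the two is strict. [folklore] -/
theorem deepTrack_turn {t : ℝ} (ht : t ∈ Icc (b.parLo hκ h7 neg_seven_mem) (b.parHi hκ h7' neg_seven_mem)) :
    0 ≤ deriv (fun t ↦ b.deepTrack hκ h7 h7' t 1) t ∧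
      b.deepTrack hκ h7 h7' t 1 * deriv (fun t ↦ b.deepTrack hκ h7 h7' t 0) t ≤ 0 ∧
      (0 < deriv (fun t ↦ b.deepTrack hκ h7 h7' t 1) t ∨ b.deepTrack hκ h7 h7' t 1 * deriv (fun t ↦ b.deepTrack hκ h7 h7' t 0) t < 0) := by
  have h45 : b.parLo hκ h7 nine_halves_mem < b.parLo hκ h7 five_mem := b.parLo_lt_parLo hκ h7 nine_halves_mem five_mem (by norm_num)
  have h45' : b.parHi hκ h7' five_mem < b.parHi hκ h7' nine_halves_mem := b.parHi_lt_parHi hκ h7' nine_halves_mem five_mem (by norm_num)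
  rcases lt_or_ge t (b.parLo hκ h7 five_mem) with h5 | h5
  · -- lower zone
    have hd := b.hasDerivAt_deepTrack_lower hκ h7 h7' h5
    rw [deriv_coord_eq hd 0, deriv_coord_eq hd 1, pt2_apply_zero, pt2_apply_one, b.deepTrack_of_le hκ h7 h7' h5.le, lowerTurn_apply_one]
    have hc : t ∈ Icc (b.tcLo - b.epsLo / 8) (b.tcLo + b.epsLo / 8) := b.mem_coreLo_of_zone hκ h7 ⟨ht.1, h5.le⟩
    have hα5 : b.alphaLo κ t ≤ 5 := ((b.alphaLo_lt_iff' hκ h7 five_mem hc).2 h5).le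
    have hχ : 0 < deriv b.chiLo t / κ := div_pos (b.deriv_chiLo_pos hc) hκ
    have hX' := deriv_turnX_nonneg (b.alphaLo κ t)
    have hV' := deriv_turnV_nonneg (b.alphaLo κ t)
    have hV := turnV_mem hα5
    refine ⟨mul_nonneg hV' hχ.le, ?_, ?_⟩
    · have : 0 ≤ deriv turnX (b.alphaLo κ t) * (deriv b.chiLo t / κ) := mul_nonneg hX' hχ.le
      nlinarith [hV.2]
    · rcases lt_or_ge (b.alphaLo κ t) 4 with h4 | h4
      · right
        have : 0 < deriv turnX (b.alphaLo κ t) * (deriv b.chiLo t / κ) := mul_pos (deriv_turnX_pos h4) hχ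
        nlinarith [hV.2]
      · left; exact mul_pos (deriv_turnV_pos (by linarith)) hχ
  rcases le_or_gt t (b.parHi hκ h7' five_mem) with h5' | h5'
  · -- tip zone
    have hd := b.hasDerivAt_deepTrack_tip hκ h7 h7' ⟨by linarith, by linarith⟩
    rw [deriv_coord_eq hd 0, deriv_coord_eq hd 1, pt2_apply_zero, pt2_apply_one, mul_zero]
    have hp := b.deriv_tipClock_pos_tipZone hκ h7 h7' ⟨by linarith, by linarith⟩
    exact ⟨hp.le, le_rfl, Or.inl hp⟩
  · -- upper zone
    have hd := b.hasDerivAt_deepTrack_upper hκ h7 h7' h5'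
    rw [deriv_coord_eq hd 0, deriv_coord_eq hd 1, pt2_apply_zero, pt2_apply_one, b.deepTrack_of_ge hκ h7 h7' h5'.le, upperTurn_apply_one]
    have hc : t ∈ Icc (b.tcHi - b.epsHi / 8) (b.tcHi + b.epsHi / 8) := b.mem_coreHi_of_zone hκ h7' ⟨h5'.le, ht.2⟩
    have hα5 : b.alphaHi κ t ≤ 5 := ((b.alphaHi_lt_iff' hκ h7' five_mem hc).2 h5').le
    have hχ : deriv b.chiHi t / κ < 0 := div_neg_of_neg_of_pos (b.deriv_chiHi_neg hc) hκ
    have hX' := deriv_turnX_nonneg (b.alphaHi κ t)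
    have hV' := deriv_turnV_nonneg (b.alphaHi κ t)
    have hV := turnV_mem hα5
    refine ⟨by nlinarith, ?_, ?_⟩
    · have : deriv turnX (b.alphaHi κ t) * (deriv b.chiHi t / κ) ≤ 0 := mul_nonpos_of_nonneg_of_nonpos hX' hχ.le
      nlinarith [hV.2]
    · rcases lt_or_ge (b.alphaHi κ t) 4 with h4 | h4
      · right
        have : deriv turnX (b.alphaHi κ t) * (deriv b.chiHi t / κ) < 0 := mul_neg_of_pos_of_neg (deriv_turnX_pos h4) hχ
        nlinarith [hV.2]
      · left
        have := deriv_turnV_pos (show (15 / 4 : ℝ) < b.alphaHi κ t by linarith)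
        nlinarith

end Track

section RailMono

variable {A B K : Knot} {avoid : Set (𝕊 3)} (b : BandData A B K avoid)

/-- The first coordinate of the upper rail arch is nonincreasing. [folklore] -/
theorem deriv_railUp_zero_nonpos (t : ℝ) : deriv (fun s ↦ b.railUp s 0) t ≤ 0 := by
  have e : (fun s ↦ b.railUp s 0) = fun s ↦ smoothStep (-b.ahi + b.epsHi) (-b.thi - b.epsHi) (-s) := by
    funext s; rfl
  have hd : HasDerivAt (fun s ↦ smoothStep (-b.ahi + b.epsHi) (-b.thi - b.epsHi) (-s))
      (deriv (smoothStep (-b.ahi + b.epsHi) (-b.thi - b.epsHi)) (-t) * (-1)) t :=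
    (((differentiable_smoothStep _ _) (-t)).hasDerivAt).comp t (hasDerivAt_neg t)
  rw [e, hd.deriv]
  have hab : -b.ahi + b.epsHi < -b.thi - b.epsHi := by linarith [b.cUp_hyp.2.1, b.cUp_hyp.1]
  have := deriv_smoothStep_nonneg hab (-t)
  linarith

/-- The first coordinate of the lower rail arch is nondecreasing. [folklore] -/
theorem deriv_railLo_zero_nonneg (t : ℝ) : 0 ≤ deriv (fun s ↦ b.railLo s 0) t := by
  have e : (fun s ↦ b.railLo s 0) = smoothStep (b.alo + b.epsLo) (b.tlo - b.epsLo) := by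
    funext s; rfl
  rw [e]
  exact deriv_smoothStep_nonneg (by linarith [b.cLo_hyp.2.1, b.cLo_hyp.1]) t

end RailMono

section Flip

variable {A₁ B₁ K₁ : Knot} {b₁ : BandData A₁ B₁ K₁ ∅} {A₂ B₂ K₂ : Knot} {b₂ : BandData A₂ B₂ K₂ ∅}
  {hcross₁ : b₁.band ⁻¹' sphereEquator 2 ∩ squareNhd b₁.δ = {x ∈ squareNhd b₁.δ | x 0 = 2⁻¹}}
  {hcross₂ : b₂.band ⁻¹' sphereEquator 2 ∩ squareNhd b₂.δ = {x ∈ squareNhd b₂.δ | x 0 = 2⁻¹}}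
  {σ₁ ε₁ r₁ A₁' κ ε₂ r₂ : ℝ} (h₁ : b₁.SpikeScale hcross₁ σ₁ ε₁ r₁ A₁' κ) (h₂ : b₂.ArcScale hcross₂ ε₂ r₂ κ)

/-! ### The end loop of the cleaning family: monotone height and the turning inequality -/

/-- The end loop of the cleaning family is `(x₀ of the track, cleaned height)`. [folklore] -/
theorem cleanP_one_eq (σ : ℝ) : cleanP h₁ h₂ 1 σ = pt2 (cleanQ h₁ h₂ σ 0) (cleanH h₁ h₂ σ) := by
  ext i; fin_cases i <;> simp [cleanP]

/-- Second coordinate of the end loop. [folklore] -/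
theorem cleanP_one_apply_one (σ : ℝ) : cleanP h₁ h₂ 1 σ 1 = cleanH h₁ h₂ σ := by
  rw [cleanP_one_eq]; rfl

/-- **On the extended foreign zone: monotone height and turning**, from the planar deep track.
[folklore] -/
theorem cleanH_turn_foreign {σ : ℝ}
    (hσ : σ ∈ Ioo (b₁.parHi h₁.κ_pos h₁.seven_le_gapHi neg_three_quarters_mem) (b₁.parLo h₁.κ_pos h₁.seven_le_gapLo neg_three_quarters_mem + 1))
    (hσ' : σ ∈ Ioo b₁.tcHi (b₁.tcLo + 1)) :
    deriv (cleanH h₁ h₂) σ ≤ 0 ∧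
      (cleanH h₁ h₂ σ - 2⁻¹) * deriv (fun σ ↦ cleanQ h₁ h₂ σ 0) σ + 3 * deriv (cleanH h₁ h₂) σ < 0 := by
  have hκ := h₁.κ_pos
  set dT := b₂.deepTrack hκ h₂.seven_le_gapLo h₂.seven_le_gapHi with hdT
  obtain ⟨hθ, hpos⟩ := hasDerivAt_theta h₁ h₂ hσ
  have hτ := Ioo_subset_Icc_self (theta_mem_Ioo h₁ h₂ σ)
  obtain ⟨m1, m2, m3⟩ := b₂.deepTrack_turn hκ h₂.seven_le_gapLo h₂.seven_le_gapHi hτ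
  -- the coordinates near `σ`
  have hD0 : HasDerivAt (fun τ ↦ dT τ 0) (deriv (fun τ ↦ dT τ 0) (theta h₁ h₂ σ)) (theta h₁ h₂ σ) :=
    (((contDiff_euclidean.1 (b₂.contDiff_deepTrack hκ h₂.seven_le_gapLo h₂.seven_le_gapHi) 0).differentiable (by simp)) _).hasDerivAt
  have hD1 : HasDerivAt (fun τ ↦ dT τ 1) (deriv (fun τ ↦ dT τ 1) (theta h₁ h₂ σ)) (theta h₁ h₂ σ) :=
    (((contDiff_euclidean.1 (b₂.contDiff_deepTrack hκ h₂.seven_le_gapLo h₂.seven_le_gapHi) 1).differentiable (by simp)) _).hasDerivAt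
  have hc0 : HasDerivAt (fun σ ↦ dT (theta h₁ h₂ σ) 0) (deriv (fun τ ↦ dT τ 0) (theta h₁ h₂ σ) * deriv (jc h₁ h₂) σ) σ :=
    HasDerivAt.comp (h₂ := fun τ ↦ dT τ 0) (h := theta h₁ h₂) σ hD0 hθ
  have hc1 : HasDerivAt (fun σ ↦ dT (theta h₁ h₂ σ) 1) (deriv (fun τ ↦ dT τ 1) (theta h₁ h₂ σ) * deriv (jc h₁ h₂) σ) σ :=
    HasDerivAt.comp (h₂ := fun τ ↦ dT τ 1) (h := theta h₁ h₂) σ hD1 hθ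
  have hevH : cleanH h₁ h₂ =ᶠ[𝓝 σ] fun σ ↦ 2⁻¹ - κ * dT (theta h₁ h₂ σ) 1 := by
    filter_upwards [Ioo_mem_nhds hσ.1 hσ.2, Ioo_mem_nhds hσ'.1 hσ'.2] with t ht ht'
    rw [cleanH_of_mem h₁ h₂ ⟨ht'.1, ht'.2.le⟩, cleanQ_eq_flipTrack h₁ h₂ (Ioo_subset_Icc_self ht), flipTrack_apply_one]
  have hevQ : (fun σ ↦ cleanQ h₁ h₂ σ 0) =ᶠ[𝓝 σ] fun σ ↦ 2⁻¹ - κ * dT (theta h₁ h₂ σ) 0 := by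
    filter_upwards [Ioo_mem_nhds hσ.1 hσ.2] with t ht
    rw [cleanQ_eq_flipTrack h₁ h₂ (Ioo_subset_Icc_self ht), flipTrack_apply_zero]
  have hH : HasDerivAt (fun σ ↦ 2⁻¹ - κ * dT (theta h₁ h₂ σ) 1) (0 - κ * (deriv (fun τ ↦ dT τ 1) (theta h₁ h₂ σ) * deriv (jc h₁ h₂) σ)) σ :=
    (hasDerivAt_const σ _).sub (hc1.const_mul κ)
  have hQ : HasDerivAt (fun σ ↦ 2⁻¹ - κ * dT (theta h₁ h₂ σ) 0) (0 - κ * (deriv (fun τ ↦ dT τ 0) (theta h₁ h₂ σ) * deriv (jc h₁ h₂) σ)) σ :=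
    (hasDerivAt_const σ _).sub (hc0.const_mul κ)
  have vH : cleanH h₁ h₂ σ = 2⁻¹ - κ * dT (theta h₁ h₂ σ) 1 := hevH.eq_of_nhds
  rw [hevH.deriv_eq, hevQ.deriv_eq, hH.deriv, hQ.deriv, vH]
  set θ' := deriv (jc h₁ h₂) σ
  set X' := deriv (fun τ ↦ dT τ 0) (theta h₁ h₂ σ)
  set V' := deriv (fun τ ↦ dT τ 1) (theta h₁ h₂ σ)
  set V := dT (theta h₁ h₂ σ) 1
  have hkθ : 0 < κ * θ' := mul_pos hκ hpos
  constructor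
  · have : 0 ≤ κ * (V' * θ') := mul_nonneg hκ.le (mul_nonneg m1 hpos.le)
    linarith
  · have e : (2⁻¹ - κ * V - 2⁻¹) * (0 - κ * (X' * θ')) + 3 * (0 - κ * (V' * θ')) = κ * θ' * (κ * (V * X') - 3 * V') := by ring
    rw [e]
    have hVX : κ * (V * X') ≤ 0 := mul_nonpos_of_nonneg_of_nonpos hκ.le m2
    have hneg : κ * (V * X') - 3 * V' < 0 := by
      rcases m3 with h | h
      · linarith
      · have : κ * (V * X') < 0 := mul_neg_of_pos_of_neg hκ h
        linarith
    exact mul_neg_of_pos_of_neg hkθ hneg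

set_option maxHeartbeats 800000 in
/-- **THE END LOOP: MONOTONE HEIGHT AND THE TURNING INEQUALITY ON THE BAND PART.** For
`σ ∈ [thi₁ + epsHi/2, tlo₁ + 1 - epsLo/2]`: the cleaned height is nonincreasing, and
`(H - 1/2)·x₀' + 3 H' < 0`. [folklore] -/
theorem cleanH_turn {σ : ℝ} (hσ : σ ∈ Icc (b₁.thi + b₁.epsHi / 2) (b₁.tlo + 1 - b₁.epsLo / 2)) :
    deriv (cleanH h₁ h₂) σ ≤ 0 ∧
      (cleanH h₁ h₂ σ - 2⁻¹) * deriv (fun σ ↦ cleanQ h₁ h₂ σ 0) σ + 3 * deriv (cleanH h₁ h₂) σ < 0 := by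
  have hκ := h₁.κ_pos
  have hκ12 := h₁.κ_le
  have hw := b₁.tcHi_window
  have hw' := b₁.tcLo_window
  have hε := b₁.epsLo_bounds.1
  have hε' := b₁.epsHi_bounds.1
  have hcm := b₁.core_marks
  have hm := b₁.marks_lt
  obtain ⟨u1, u2⟩ := b₁.thi_marksB
  obtain ⟨l1, l2⟩ := b₁.tlo_marksB
  have n5 := (b₁.parHi_mem_core hκ h₁.seven_le_gapHi neg_five_quarters_mem).1
  have n5' := (b₁.parHi_mem_core hκ h₁.seven_le_gapHi neg_five_quarters_mem).2
  have n34 := b₁.parHi_lt_parHi hκ h₁.seven_le_gapHi neg_five_quarters_mem neg_three_quarters_mem (by norm_num)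
  have l72 := (b₁.parLo_mem_core hκ h₁.seven_le_gapLo neg_seven_halves_mem).1
  have l72' := (b₁.parLo_mem_core hκ h₁.seven_le_gapLo neg_seven_halves_mem).2
  have l34 := b₁.parLo_lt_parLo hκ h₁.seven_le_gapLo neg_seven_halves_mem neg_three_quarters_mem (by norm_num)
  have p1 : b₁.tcHi < b₁.parHi hκ h₁.seven_le_gapHi neg_five_quarters_mem := by
    rw [← b₁.parHi_zero hκ h₁.seven_le_gapHi]; exact b₁.parHi_lt_parHi hκ h₁.seven_le_gapHi neg_five_quarters_mem _ (by norm_num)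
  have p2 : b₁.parLo hκ h₁.seven_le_gapLo neg_seven_halves_mem < b₁.tcLo := by
    rw [← b₁.parLo_zero hκ h₁.seven_le_gapLo]; exact b₁.parLo_lt_parLo hκ h₁.seven_le_gapLo neg_seven_halves_mem _ (by norm_num)
  -- derivative of `x₀` on the upper arch zone and on the lower arch zone
  have dUp : ∀ {s}, s < b₁.parHi hκ h₁.seven_le_gapHi neg_five_quarters_mem →
      deriv (fun σ ↦ cleanQ h₁ h₂ σ 0) s = deriv (fun σ ↦ b₁.railUp σ 0) s := fun {s} hs ↦ by
    apply Filter.EventuallyEq.deriv_eq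
    filter_upwards [Iio_mem_nhds hs] with t ht using cleanQ_zero_of_le h₁ h₂ (le_of_lt ht)
  have dLo : ∀ {s}, b₁.parLo hκ h₁.seven_le_gapLo neg_seven_halves_mem + 1 < s →
      deriv (fun σ ↦ cleanQ h₁ h₂ σ 0) s = deriv (fun σ ↦ b₁.railLo σ 0) (s - 1) := fun {s} hs ↦ by
    have hev : (fun σ ↦ cleanQ h₁ h₂ σ 0) =ᶠ[𝓝 s] fun σ ↦ b₁.railLo (σ - 1) 0 := by
      filter_upwards [Ioi_mem_nhds hs] with t ht using cleanQ_zero_of_ge h₁ h₂ (le_of_lt ht)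
    rw [hev.deriv_eq]
    have hr : HasDerivAt (fun t ↦ b₁.railLo t 0) (deriv (fun t ↦ b₁.railLo t 0) (s - 1)) (s - 1) :=
      (((contDiff_euclidean.1 b₁.contDiff_railLo 0).differentiable (by simp)) _).hasDerivAt
    have hc : HasDerivAt (fun t ↦ b₁.railLo (t - 1) 0) (deriv (fun t ↦ b₁.railLo t 0) (s - 1) * 1) s :=
      HasDerivAt.comp (h₂ := fun t ↦ b₁.railLo t 0) (h := fun t : ℝ ↦ t - 1) s hr ((hasDerivAt_id s).sub_const 1)
    rw [hc.deriv, mul_one]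
  -- derivative of `H` left of `tcHi` and right of `tcLo + 1`
  have dHup : ∀ {s}, s < b₁.tcHi → deriv (cleanH h₁ h₂) s = deriv (b₁.hcUp κ) s := fun {s} hs ↦ by
    apply Filter.EventuallyEq.deriv_eq
    filter_upwards [Iio_mem_nhds hs] with t ht using cleanH_of_le h₁ h₂ (le_of_lt ht)
  have dHlo : ∀ {s}, b₁.tcLo + 1 < s → deriv (cleanH h₁ h₂) s = deriv (b₁.hcLo κ) (s - 1) := fun {s} hs ↦ by
    have hev : cleanH h₁ h₂ =ᶠ[𝓝 s] fun σ ↦ b₁.hcLo κ (σ - 1) := by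
      filter_upwards [Ioi_mem_nhds hs] with t ht using cleanH_of_gt h₁ h₂ ht
    rw [hev.deriv_eq]
    have hr : HasDerivAt (b₁.hcLo κ) (deriv (b₁.hcLo κ) (s - 1)) (s - 1) := (((b₁.contDiff_hcLo κ).differentiable (by simp)) _).hasDerivAt
    have hc : HasDerivAt (fun t ↦ b₁.hcLo κ (t - 1)) (deriv (b₁.hcLo κ) (s - 1) * 1) s :=
      HasDerivAt.comp (h₂ := b₁.hcLo κ) (h := fun t : ℝ ↦ t - 1) s hr ((hasDerivAt_id s).sub_const 1)
    rw [hc.deriv, mul_one]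
  rcases lt_or_ge σ b₁.tcHi with hA | hA
  · -- zones A', B': `H = hcUp`
    have hlo : b₁.psiInv (b₁.thetaB (17 / 20) + 1) ≤ σ := by linarith [hσ.1]
    rw [dHup hA, dUp (by linarith), cleanH_of_le h₁ h₂ hA.le]
    have hy := b₁.hcUp_mem (w := κ) (by linarith) hlo
    have hy' := b₁.deriv_hcUp_nonpos (w := κ) (by linarith) hlo
    have hx' := b₁.deriv_railUp_zero_nonpos σ
    refine ⟨hy', ?_⟩
    have hprod : (b₁.hcUp κ σ - 2⁻¹) * deriv (fun σ ↦ b₁.railUp σ 0) σ ≤ 0 :=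
      mul_nonpos_of_nonneg_of_nonpos (by linarith [hy.1]) hx'
    rcases lt_or_ge σ (b₁.thi + 2 * b₁.epsHi) with h1 | h1
    · have hs := b₁.deriv_hcUp_neg (w := κ) (by linarith) hlo h1
      linarith
    · have hs := b₁.deriv_railUp_zero_neg (t := σ) ⟨by linarith, by linarith⟩
      have : (b₁.hcUp κ σ - 2⁻¹) * deriv (fun σ ↦ b₁.railUp σ 0) σ < 0 := mul_neg_of_pos_of_neg (by linarith [hy.1]) hs
      linarith
  rcases lt_or_ge σ (b₁.parHi hκ h₁.seven_le_gapHi neg_five_quarters_mem) with hC | hC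
  · -- zone C': `H ≡ 1/2 + κ`
    have hev : cleanH h₁ h₂ =ᶠ[𝓝 σ] fun _ ↦ 2⁻¹ + κ := by
      filter_upwards [Ioo_mem_nhds (show b₁.thi + 2 * b₁.epsHi < σ by linarith) hC] with t ht
        using cleanH_eq_const_up h₁ h₂ ⟨ht.1.le, ht.2.le⟩
    rw [hev.deriv_eq, deriv_const, hev.eq_of_nhds, dUp hC]
    have hs := b₁.deriv_railUp_zero_neg (t := σ) ⟨by linarith, by linarith⟩
    refine ⟨le_rfl, ?_⟩
    have : (2⁻¹ + κ - 2⁻¹) * deriv (fun σ ↦ b₁.railUp σ 0) σ = κ * deriv (fun σ ↦ b₁.railUp σ 0) σ := by ring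
    rw [this, mul_zero, add_zero]
    exact mul_neg_of_pos_of_neg hκ hs
  rcases le_or_gt σ (b₁.parLo hκ h₁.seven_le_gapLo neg_seven_halves_mem + 1) with hD | hD
  · -- zone D': the foreign zone
    exact cleanH_turn_foreign h₁ h₂ ⟨by linarith, by linarith⟩ ⟨by linarith, by linarith⟩
  rcases le_or_gt σ (b₁.tcLo + 1) with hE | hE
  · -- zone E': `H ≡ 1/2 - κ`
    have hev : cleanH h₁ h₂ =ᶠ[𝓝 σ] fun _ ↦ 2⁻¹ - κ := by
      filter_upwards [Ioo_mem_nhds hD (show σ < b₁.tlo + 1 - 2 * b₁.epsLo by linarith)] with t ht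
        using cleanH_eq_const_lo h₁ h₂ ⟨ht.1.le, by linarith [ht.2]⟩
    rw [hev.deriv_eq, deriv_const, hev.eq_of_nhds, dLo hD]
    have hs := b₁.deriv_railLo_zero_pos (t := σ - 1) ⟨by linarith, by linarith⟩
    refine ⟨le_rfl, ?_⟩
    have : (2⁻¹ - κ - 2⁻¹) * deriv (fun σ ↦ b₁.railLo σ 0) (σ - 1) = -(κ * deriv (fun σ ↦ b₁.railLo σ 0) (σ - 1)) := by ring
    rw [this, mul_zero, add_zero, neg_lt_zero]
    exact mul_pos hκ hs
  · -- zones F', G': `H = hcLo (σ - 1)`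
    have hhi : σ - 1 ≤ b₁.psiInv (b₁.thetaB (3 / 20)) := by linarith [hσ.2]
    rw [dHlo hE, dLo (by linarith), cleanH_of_gt h₁ h₂ hE]
    have hy := b₁.hcLo_mem (w := κ) (by linarith) hhi
    have hy' := b₁.deriv_hcLo_nonpos (w := κ) (by linarith) hhi
    have hx' := b₁.deriv_railLo_zero_nonneg (σ - 1)
    refine ⟨hy', ?_⟩
    have hprod : (b₁.hcLo κ (σ - 1) - 2⁻¹) * deriv (fun σ ↦ b₁.railLo σ 0) (σ - 1) ≤ 0 :=
      mul_nonpos_of_nonpos_of_nonneg (by linarith [hy.2]) hx'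
    rcases lt_or_ge (b₁.tlo - 2 * b₁.epsLo) (σ - 1) with h1 | h1
    · have hs := b₁.deriv_hcLo_neg (w := κ) (by linarith) hhi h1
      linarith
    · have hs := b₁.deriv_railLo_zero_pos (t := σ - 1) ⟨by linarith, by linarith⟩
      have : (b₁.hcLo κ (σ - 1) - 2⁻¹) * deriv (fun σ ↦ b₁.railLo σ 0) (σ - 1) < 0 := mul_neg_of_neg_of_pos (by linarith [hy.2]) hs
      linarith

end Flip

section Shift

variable {A₁ B₁ K₁ : Knot} {b₁ : BandData A₁ B₁ K₁ ∅} {A₂ B₂ K₂ : Knot} {b₂ : BandData A₂ B₂ K₂ ∅}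

/-! ### The parameters of `A₂ = R ∘ B₁` versus those of `B₁` -/

/-- A continuous real function on an interval with integer values is constant. [folklore] -/
theorem int_valued_const {g : ℝ → ℝ} {a c : ℝ} (hg : ContinuousOn g (Icc a c))
    (hint : ∀ y ∈ Icc a c, ∃ m : ℤ, g y = m) {y y' : ℝ} (hy : y ∈ Icc a c) (hy' : y' ∈ Icc a c) : g y = g y' := by
  by_contra hne
  obtain ⟨m, hm⟩ := hint y hy
  obtain ⟨m', hm'⟩ := hint y' hy'
  have hsub : uIcc y y' ⊆ Icc a c := uIcc_subset_Icc hy hy'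
  have hcont : ContinuousOn g (uIcc y y') := hg.mono hsub
  have hIV := intermediate_value_uIcc hcont
  -- a non-integer value between `g y = m` and `g y' = m'`
  have hmm : m ≠ m' := fun h ↦ hne (by rw [hm, hm', h])
  rcases lt_or_gt_of_ne hmm with hlt | hlt
  · have hv : (m : ℝ) + 2⁻¹ ∈ uIcc (g y) (g y') := by
      rw [hm, hm']
      have : (m : ℝ) + 1 ≤ m' := by exact_mod_cast hlt
      exact mem_uIcc.2 (Or.inl ⟨by linarith, by linarith⟩)
    obtain ⟨z, hz, hzv⟩ := hIV hv
    obtain ⟨n, hn⟩ := hint z (hsub hz)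
    rw [hn] at hzv
    have h1 : (n : ℝ) < m + 1 := by linarith
    have h2 : (m : ℝ) < n := by linarith
    have h1' : n < m + 1 := by exact_mod_cast h1
    have h2' : m < n := by exact_mod_cast h2
    omega
  · have hv : (m' : ℝ) + 2⁻¹ ∈ uIcc (g y) (g y') := by
      rw [hm, hm']
      have : (m' : ℝ) + 1 ≤ m := by exact_mod_cast hlt
      exact mem_uIcc.2 (Or.inr ⟨by linarith, by linarith⟩)
    obtain ⟨z, hz, hzv⟩ := hIV hv
    obtain ⟨n, hn⟩ := hint z (hsub hz)
    rw [hn] at hzv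
    have h1 : (n : ℝ) < m' + 1 := by linarith
    have h2 : (m' : ℝ) < n := by linarith
    have h1' : n < m' + 1 := by exact_mod_cast h1
    have h2' : m' < n := by exact_mod_cast h2
    omega

/-- **`A₂` is the reflection of `B₁`.** [folklore] -/
theorem A₂_apply (hBA : B₁ = A₂.map (reflectLastDiffeo 3)) (x : 𝕊 1) : A₂ x = reflectLast 3 (B₁ x) := by
  rw [hBA, SphereEmbedding.map_apply, coe_reflectLastDiffeo, reflectLast_reflectLast]

/-- **THE PARAMETER SHIFT**: if `(b₁, b₂)` is a flip pair and `B₁ = R ∘ A₂` then the left-edge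
parameter of `b₂` and the right-edge parameter of `b₁` differ by a fixed integer:
`thetaA₂ y = thetaB₁ (1 - y) + m` on `[1/10, 9/10]`. [folklore] -/
theorem exists_thetaA_eq_thetaB (hP : IsFlipPair b₁ b₂) (hBA : B₁ = A₂.map (reflectLastDiffeo 3)) :
    ∃ m : ℤ, ∀ y ∈ Icc (10⁻¹ : ℝ) (9 / 10), b₂.thetaA y = b₁.thetaB (1 - y) + m := by
  -- pointwise
  have hpt : ∀ y ∈ Icc (10⁻¹ : ℝ) (9 / 10), ∃ m : ℤ, b₂.thetaA y = b₁.thetaB (1 - y) + m := by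
    intro y hy
    have hy' : 1 - y ∈ Icc (10⁻¹ : ℝ) (9 / 10) := ⟨by linarith [hy.2], by linarith [hy.1]⟩
    have e1 := b₂.apply_circlePt_thetaA hy
    have e2 : A₂ (circlePt (b₁.thetaB (1 - y))) = b₂.band (pt2 0 y) := by
      rw [A₂_apply hBA, b₁.apply_circlePt_thetaB hy', hP.band_eq, reflectLast_reflectLast]
      congr 1
      ext i; fin_cases i <;> simp
    exact circlePt_eq_circlePt_iff.1 (A₂.injective (e1.trans e2.symm))
  -- constancy of the integer
  have hg : ContinuousOn (fun y ↦ b₂.thetaA y - b₁.thetaB (1 - y)) (Icc 10⁻¹ (9 / 10)) := by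
    refine b₂.continuousOn_thetaA.sub (b₁.continuousOn_thetaB.comp (continuousOn_const.sub continuousOn_id) ?_)
    intro y hy; exact ⟨by linarith [hy.2], by linarith [hy.1]⟩
  have hint : ∀ y ∈ Icc (10⁻¹ : ℝ) (9 / 10), ∃ m : ℤ, (fun y ↦ b₂.thetaA y - b₁.thetaB (1 - y)) y = m := by
    intro y hy
    obtain ⟨m, hm⟩ := hpt y hy
    exact ⟨m, show b₂.thetaA y - b₁.thetaB (1 - y) = m by linarith⟩
  have h0 : (2⁻¹ : ℝ) ∈ Icc (10⁻¹ : ℝ) (9 / 10) := ⟨by norm_num, by norm_num⟩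
  obtain ⟨m, hm⟩ := hpt 2⁻¹ h0
  refine ⟨m, fun y hy ↦ ?_⟩
  have : b₂.thetaA y - b₁.thetaB (1 - y) = b₂.thetaA 2⁻¹ - b₁.thetaB (1 - 2⁻¹) := int_valued_const hg hint hy h0
  linarith

variable {hP : IsFlipPair b₁ b₂} {hBA : B₁ = A₂.map (reflectLastDiffeo 3)}

/-- **The parameter shift** `m` with `thetaA₂ y = thetaB₁ (1 - y) + m`. [folklore] -/
def shift (hP : IsFlipPair b₁ b₂) (hBA : B₁ = A₂.map (reflectLastDiffeo 3)) : ℤ :=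
  (exists_thetaA_eq_thetaB hP hBA).choose

/-- The defining property of the shift. [folklore] -/
theorem thetaA_eq (hP : IsFlipPair b₁ b₂) (hBA : B₁ = A₂.map (reflectLastDiffeo 3)) {y : ℝ} (hy : y ∈ Icc (10⁻¹ : ℝ) (9 / 10)) :
    b₂.thetaA y = b₁.thetaB (1 - y) + shift hP hBA := (exists_thetaA_eq_thetaB hP hBA).choose_spec y hy

/-- **Heights of `A₂` versus heights of `B₁`**: `heightA₂ θ = 1 - heightB₁ (θ - m)` on the window of
`A₂`. [folklore] -/
theorem heightA_eq (hP : IsFlipPair b₁ b₂) (hBA : B₁ = A₂.map (reflectLastDiffeo 3)) {θ : ℝ}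
    (hθ : θ ∈ Icc (b₂.thetaA 10⁻¹) (b₂.thetaA (9 / 10))) :
    b₂.heightA θ = 1 - b₁.heightB (θ - shift hP hBA) := by
  obtain ⟨h1, h2⟩ := b₂.thetaA_heightA hθ
  have h3 := thetaA_eq hP hBA h2
  rw [h1] at h3
  have h4 : b₁.thetaB (1 - b₂.heightA θ) = θ - shift hP hBA := by linarith
  have h5 : 1 - b₂.heightA θ ∈ Icc (10⁻¹ : ℝ) (9 / 10) := ⟨by linarith [h2.2], by linarith [h2.1]⟩
  have := b₁.heightB_thetaB h5
  rw [h4] at this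
  linarith

/-- The ends of the window of `A₂` in terms of `thetaB₁`. [folklore] -/
theorem thetaA_ends (hP : IsFlipPair b₁ b₂) (hBA : B₁ = A₂.map (reflectLastDiffeo 3)) :
    b₂.thetaA 10⁻¹ = b₁.thetaB (9 / 10) + shift hP hBA ∧ b₂.thetaA (9 / 10) = b₁.thetaB 10⁻¹ + shift hP hBA := by
  constructor
  · rw [thetaA_eq hP hBA ⟨le_rfl, by norm_num⟩]; norm_num
  · rw [thetaA_eq hP hBA ⟨by norm_num, le_rfl⟩]; norm_num

/-! ### The reparametrisation of the band part by the parameter of `A₂` -/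

/-- **A smooth increasing map with two prescribed parallel affine germs** (slope `1/λ`): given marks
`q₁ < q₂` and parallel lines `ℓ₁ θ = (θ - k)/λ`, `ℓ₂ = ℓ₁ + d` with `ℓ₁ q₁ < ℓ₂ q₂`, there is a `C^∞`
map `φ`, increasing with positive derivative on a neighbourhood `[q₁ - 1, q₂ + 1]`, equal to `ℓ₁` on
`[q₁ - 1, q₁]` and to `ℓ₂` on `[q₂, q₂ + 1]`. [folklore] -/
theorem exists_reparam {lam k d q₁ q₂ : ℝ} (hlam : 0 < lam) (hq : q₁ < q₂) (hd : (q₁ - k) / lam < (q₂ - k) / lam + d) :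
    ∃ φ : ℝ → ℝ, ContDiff ℝ ∞ φ ∧ (∀ θ ∈ Icc (q₁ - 1) (q₂ + 1), 0 < deriv φ θ) ∧
      (∀ θ ∈ Icc (q₁ - 1) q₁, φ θ = (θ - k) / lam) ∧ (∀ θ ∈ Icc q₂ (q₂ + 1), φ θ = (θ - k) / lam + d) := by
  rcases le_or_gt 0 d with hd0 | hd0
  · -- `d ≥ 0`: blend the two lines
    set χ := smoothStep q₁ q₂ with hχ
    refine ⟨fun θ ↦ (θ - k) / lam + d * χ θ, ?_, fun θ _ ↦ ?_, fun θ hθ ↦ ?_, fun θ hθ ↦ ?_⟩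
    · exact ((contDiff_id.sub contDiff_const).div_const _).add (contDiff_const.mul (contDiff_smoothStep _ _))
    · have hd' : HasDerivAt (fun θ ↦ (θ - k) / lam + d * χ θ) (1 / lam + d * deriv χ θ) θ :=
        (((hasDerivAt_id θ).sub_const k).div_const lam).add (((differentiable_smoothStep _ _ θ).hasDerivAt).const_mul d)
      rw [hd'.deriv]
      have := deriv_smoothStep_nonneg hq θ
      have : 0 ≤ d * deriv χ θ := mul_nonneg hd0 this
      have : 0 < 1 / lam := by positivity
      linarith
    · simp only [hχ, smoothStep_of_le hq hθ.2, mul_zero, add_zero]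
    · simp only [hχ, smoothStep_of_ge hq hθ.1, mul_one]
  · -- `d < 0`: invert the blend `ψ₀ s = λ s + k + λ|d| S s` of the inverse lines
    -- inverse lines: `ℓ₁⁻¹ s = λ s + k`, `ℓ₂⁻¹ s = λ (s - d) + k = λ s + k - λ d`
    set s₁ := (q₁ - k) / lam with hs₁
    set s₂ := (q₂ - k) / lam + d with hs₂
    have hs12 : s₁ < s₂ := hd
    set S := smoothStep s₁ s₂ with hS
    set ψ₀ : ℝ → ℝ := fun s ↦ lam * s + k - lam * d * S s with hψ₀
    have hψs : ContDiff ℝ ∞ ψ₀ := ((contDiff_const.mul contDiff_id).add contDiff_const).sub (contDiff_const.mul (contDiff_smoothStep _ _))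
    have hψd : ∀ s, HasDerivAt ψ₀ (lam * 1 - lam * d * deriv S s) s := fun s ↦
      (((hasDerivAt_id s).const_mul lam).add_const k).sub ((((differentiable_smoothStep s₁ s₂) s).hasDerivAt).const_mul (lam * d))
    have hψd_pos : ∀ s, 0 < deriv ψ₀ s := fun s ↦ by
      rw [(hψd s).deriv, mul_one]
      have := deriv_smoothStep_nonneg hs12 s
      have : 0 ≤ -(lam * d) * deriv S s := mul_nonneg (by nlinarith) this
      linarith
    have hψmono : StrictMono ψ₀ := strictMono_of_deriv_pos hψd_pos
    have hψ1 : ∀ s, s ≤ s₁ → ψ₀ s = lam * s + k := fun s hs ↦ by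
      simp only [hψ₀, hS, smoothStep_of_le hs12 hs, mul_zero, sub_zero]
    have hψ2 : ∀ s, s₂ ≤ s → ψ₀ s = lam * s + k - lam * d := fun s hs ↦ by
      simp only [hψ₀, hS, smoothStep_of_ge hs12 hs, mul_one]
    have vψ1 : ψ₀ s₁ = q₁ := by rw [hψ1 s₁ le_rfl, hs₁]; field_simp; ring
    have vψ2 : ψ₀ s₂ = q₂ := by rw [hψ2 s₂ le_rfl, hs₂]; field_simp; ring
    -- invert on a big interval
    set u₀ := s₁ - 2 / lam with hu₀
    set u₁ := s₂ + 2 / lam with hu₁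
    have hu : u₀ < u₁ := by
      have : 0 < 2 / lam := by positivity
      rw [hu₀, hu₁]; linarith
    have h2l : (0 : ℝ) < 2 / lam := by positivity
    have hu₀le : u₀ ≤ s₁ := by simp only [hu₀]; linarith
    have hu₁ge : s₂ ≤ u₁ := by simp only [hu₁]; linarith
    have vu₀ : ψ₀ u₀ = q₁ - 2 := by
      rw [hψ1 u₀ hu₀le, hu₀, hs₁]; field_simp; ring
    have vu₁ : ψ₀ u₁ = q₂ + 2 := by
      rw [hψ2 u₁ hu₁ge, hu₁, hs₂]; field_simp; ring
    obtain ⟨hY1, hY2, hYmono⟩ := MonoInverse hu hψs.continuous.continuousOn (hψmono.strictMonoOn _)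
    have hYs := MonoInverse_smooth hu hψs.continuous.continuousOn (hψmono.strictMonoOn _) (fun u _ ↦ hψs.contDiffAt) (fun u _ ↦ hψd_pos u)
    set Y := invFunOn ψ₀ (Icc u₀ u₁) with hYdef
    -- every `θ ∈ (q₁ - 2, q₂ + 2)` is `ψ₀ u` with `u ∈ (u₀, u₁)`
    have hsurj : ∀ θ ∈ Ioo (q₁ - 2) (q₂ + 2), ∃ u ∈ Ioo u₀ u₁, ψ₀ u = θ := by
      intro θ hθ
      have hθ' : θ ∈ Icc (ψ₀ u₀) (ψ₀ u₁) := by rw [vu₀, vu₁]; exact ⟨hθ.1.le, hθ.2.le⟩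
      obtain ⟨hval, hmem⟩ := hY2 θ hθ'
      refine ⟨Y θ, ⟨lt_of_le_of_ne hmem.1 fun h ↦ ?_, lt_of_le_of_ne hmem.2 fun h ↦ ?_⟩, hval⟩
      · rw [← h, vu₀] at hval; linarith [hθ.1]
      · rw [h, vu₁] at hval; linarith [hθ.2]
    have hYat : ∀ θ ∈ Ioo (q₁ - 2) (q₂ + 2), ContDiffAt ℝ ∞ Y θ ∧ 0 < deriv Y θ := by
      intro θ hθ
      obtain ⟨u, hu', rfl⟩ := hsurj θ hθ
      obtain ⟨hs, hd'⟩ := hYs u hu'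
      exact ⟨hs, by rw [hd']; exact inv_pos.2 (hψd_pos u)⟩
    -- globalise
    have o1 : q₁ - 2 < q₁ - 1 := by linarith
    have o2 : q₁ - 1 < q₂ + 1 := by linarith
    have o3 : q₂ + 1 < q₂ + 2 := by linarith
    obtain ⟨φ, hφs, hφeq, hφd, -, -, -⟩ := exists_increasing_extension_left o1 o2 o3 (fun θ hθ ↦ (hYat θ hθ).1) (fun θ hθ ↦ (hYat θ hθ).2)
    refine ⟨φ, hφs, fun θ hθ ↦ hφd θ hθ.2, fun θ hθ ↦ ?_, fun θ hθ ↦ ?_⟩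
    · -- `φ θ = Y θ = ℓ₁ θ`: `θ = ψ₀ ((θ - k)/λ)` with `(θ - k)/λ ≤ s₁`
      rw [hφeq θ ⟨hθ.1, by linarith [hθ.2]⟩]
      have hle : (θ - k) / lam ≤ s₁ := by rw [hs₁]; exact div_le_div_of_nonneg_right (by linarith [hθ.2]) hlam.le
      have hmem : (θ - k) / lam ∈ Icc u₀ u₁ := by
        constructor
        · rw [hu₀, hs₁]
          have : (q₁ - k) / lam - 2 / lam = (q₁ - 2 - k) / lam := by field_simp; ring
          rw [this]; exact div_le_div_of_nonneg_right (by linarith [hθ.1]) hlam.le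
        · linarith [hs12]
      have e : ψ₀ ((θ - k) / lam) = θ := by rw [hψ1 _ hle]; field_simp; ring
      have := hY1 _ hmem
      rw [e] at this; exact this
    · rw [hφeq θ ⟨by linarith [hθ.1], hθ.2⟩]
      have hge : s₂ ≤ (θ - k) / lam + d := by
        rw [hs₂]; have := div_le_div_of_nonneg_right (show q₂ - k ≤ θ - k by linarith [hθ.1]) hlam.le; linarith
      have hmem : (θ - k) / lam + d ∈ Icc u₀ u₁ := by
        constructor
        · linarith [hs12]
        · rw [hu₁, hs₂]
          have : (q₂ - k) / lam + d + 2 / lam = (q₂ + 2 - k) / lam + d := by field_simp; ring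
          rw [this]; have := div_le_div_of_nonneg_right (show θ - k ≤ q₂ + 2 - k by linarith [hθ.2]) hlam.le; linarith
      have e : ψ₀ ((θ - k) / lam + d) = θ := by rw [hψ2 _ hge]; field_simp; ring
      have := hY1 _ hmem
      rw [e] at this; exact this

end Shift

section Edge

variable {A₁ B₁ K₁ : Knot} {b₁ : BandData A₁ B₁ K₁ ∅} {A₂ B₂ K₂ : Knot} {b₂ : BandData A₂ B₂ K₂ ∅}
  {hcross₁ : b₁.band ⁻¹' sphereEquator 2 ∩ squareNhd b₁.δ = {x ∈ squareNhd b₁.δ | x 0 = 2⁻¹}}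
  {hcross₂ : b₂.band ⁻¹' sphereEquator 2 ∩ squareNhd b₂.δ = {x ∈ squareNhd b₂.δ | x 0 = 2⁻¹}}
  {σ₁ ε₁ r₁ A₁' κ ε₂ r₂ : ℝ} (h₁ : b₁.SpikeScale hcross₁ σ₁ ε₁ r₁ A₁' κ) (h₂ : b₂.ArcScale hcross₂ ε₂ r₂ κ)
  (hP : IsFlipPair b₁ b₂) (hBA : B₁ = A₂.map (reflectLastDiffeo 3))

/-! ### The marks on the circle of `A₂` -/

/-- Start of the band part in the parameter of `A₂`: `psi₁ (thi₁ + epsHi/2) - 1 + m`. [folklore] -/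
def p₁ (hP : IsFlipPair b₁ b₂) (hBA : B₁ = A₂.map (reflectLastDiffeo 3)) : ℝ := b₁.psi (b₁.thi + b₁.epsHi / 2) - 1 + shift hP hBA

/-- End of the upper edge zone: `psi₁ (thi₁ + epsHi) - 1 + m`. [folklore] -/
def p₁' (hP : IsFlipPair b₁ b₂) (hBA : B₁ = A₂.map (reflectLastDiffeo 3)) : ℝ := b₁.psi (b₁.thi + b₁.epsHi) - 1 + shift hP hBA

/-- Start of the lower edge zone: `psi₁ (tlo₁ - epsLo) + m`. [folklore] -/
def p₂' (hP : IsFlipPair b₁ b₂) (hBA : B₁ = A₂.map (reflectLastDiffeo 3)) : ℝ := b₁.psi (b₁.tlo - b₁.epsLo) + shift hP hBA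

/-- End of the band part: `psi₁ (tlo₁ - epsLo/2) + m`. [folklore] -/
def p₂ (hP : IsFlipPair b₁ b₂) (hBA : B₁ = A₂.map (reflectLastDiffeo 3)) : ℝ := b₁.psi (b₁.tlo - b₁.epsLo / 2) + shift hP hBA

omit h₁ h₂ in
/-- **Order of the marks**: `thetaA₂ (1/10) < p₁ < p₁' < p₂' < p₂ < thetaA₂ (9/10)`, and the two edge
zones have length `< 1`. [folklore] -/
theorem marks_A :
    b₂.thetaA 10⁻¹ < p₁ hP hBA ∧ p₁ hP hBA < p₁' hP hBA ∧ p₁' hP hBA < p₂' hP hBA ∧ p₂' hP hBA < p₂ hP hBA ∧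
      p₂ hP hBA < b₂.thetaA (9 / 10) ∧ p₁' hP hBA - p₁ hP hBA < 1 ∧ p₂ hP hBA - p₂' hP hBA < 1 := by
  obtain ⟨e1, e2⟩ := thetaA_ends hP hBA
  obtain ⟨hε, -, hε2⟩ := b₁.epsLo_bounds
  obtain ⟨hε', -, hε2'⟩ := b₁.epsHi_bounds
  have hl := b₁.lam_pos
  have hwin := b₁.thetaB_window
  have hB := b₁.strictAntiOn_thetaB
  have t1 : b₁.thetaB (9 / 10) < b₁.thetaB (4 / 5) := hB (by norm_num) (by norm_num) (by norm_num)
  have t2 : b₁.thetaB (4 / 5) < b₁.thetaB (7 / 10) := hB (by norm_num) (by norm_num) (by norm_num)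
  have t3 : b₁.thetaB (7 / 10) < b₁.thetaB (3 / 10) := hB (by norm_num) (by norm_num) (by norm_num)
  have t4 : b₁.thetaB (3 / 10) < b₁.thetaB (1 / 5) := hB (by norm_num) (by norm_num) (by norm_num)
  have t5 : b₁.thetaB (1 / 5) < b₁.thetaB 10⁻¹ := hB (by norm_num) (by norm_num) (by norm_num)
  have hthi := b₁.psi_thi
  have v1 : b₁.psi (b₁.thi + b₁.epsHi / 2) = b₁.thetaB (4 / 5) + 1 + b₁.epsHi / 2 * b₁.lam := by
    simp only [psi] at hthi ⊢; linarith
  have v1' : b₁.psi (b₁.thi + b₁.epsHi) = b₁.thetaB (4 / 5) + 1 + b₁.epsHi * b₁.lam := by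
    simp only [psi] at hthi ⊢; linarith
  have v2' : b₁.psi (b₁.tlo - b₁.epsLo) = b₁.thetaB (1 / 5) - b₁.epsLo * b₁.lam := by simp only [psi]; ring
  have v2 : b₁.psi (b₁.tlo - b₁.epsLo / 2) = b₁.thetaB (1 / 5) - b₁.epsLo / 2 * b₁.lam := by simp only [psi]; ring
  simp only [p₁, p₁', p₂', p₂, e1, e2, v1, v1', v2', v2]
  have hp1 : 0 < b₁.epsHi / 2 * b₁.lam := by positivity
  have hp2 : 0 < b₁.epsLo / 2 * b₁.lam := by positivity
  have hq1 : b₁.epsHi / 2 * b₁.lam = (2 * b₁.epsHi * b₁.lam) / 4 := by ring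
  have hq2 : b₁.epsLo / 2 * b₁.lam = (2 * b₁.epsLo * b₁.lam) / 4 := by ring
  have hq3 : b₁.epsHi * b₁.lam = (2 * b₁.epsHi * b₁.lam) / 2 := by ring
  have hq4 : b₁.epsLo * b₁.lam = (2 * b₁.epsLo * b₁.lam) / 2 := by ring
  refine ⟨by linarith, by linarith, ?_, by linarith, by linarith, by linarith, by linarith⟩
  rw [hq3, hq4]; linarith

/-! ### The reparametrisation `φ` -/

omit h₁ h₂ in
/-- **Existence of the reparametrisation** of the band part by the parameter of `A₂`. [folklore] -/
theorem exists_phi : ∃ φ : ℝ → ℝ, ContDiff ℝ ∞ φ ∧ (∀ θ ∈ Icc (p₁ hP hBA) (p₂ hP hBA), 0 < deriv φ θ) ∧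
    (∀ θ ∈ Icc (p₁ hP hBA) (p₁' hP hBA), φ θ = b₁.psiInv (θ - shift hP hBA + 1)) ∧
    (∀ θ ∈ Icc (p₂' hP hBA) (p₂ hP hBA), φ θ = b₁.psiInv (θ - shift hP hBA) + 1) := by
  obtain ⟨m1, m2, m3, m4, m5, m6, m7⟩ := marks_A hP hBA
  have hl := b₁.lam_pos
  have hm := b₁.marks_lt
  obtain ⟨hε, hε5', -⟩ := b₁.epsLo_bounds
  obtain ⟨hε', hε5, -⟩ := b₁.epsHi_bounds
  set k := (shift hP hBA : ℝ) - 1 + b₁.thetaB (1 / 5) with hk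
  set d := 1 - 1 / b₁.lam with hd
  -- the two lines
  have hl1 : ∀ θ, b₁.psiInv (θ - shift hP hBA + 1) = (θ - k) / b₁.lam + b₁.tlo := fun θ ↦ by
    simp only [psiInv, hk]; ring
  have hl2 : ∀ θ, b₁.psiInv (θ - shift hP hBA) + 1 = (θ - k) / b₁.lam + b₁.tlo + d := fun θ ↦ by
    simp only [psiInv, hk, hd]; field_simp; ring
  have hcond : (p₁' hP hBA - k) / b₁.lam < (p₂' hP hBA - k) / b₁.lam + d := by
    have e1 : (p₁' hP hBA - k) / b₁.lam = b₁.psiInv (p₁' hP hBA - shift hP hBA + 1) - b₁.tlo := by rw [hl1]; ring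
    have e2 : (p₂' hP hBA - k) / b₁.lam + d = b₁.psiInv (p₂' hP hBA - shift hP hBA) + 1 - b₁.tlo := by rw [hl2]; ring
    rw [e1, e2, p₁', p₂', show b₁.psi (b₁.thi + b₁.epsHi) - 1 + ↑(shift hP hBA) - ↑(shift hP hBA) + 1 = b₁.psi (b₁.thi + b₁.epsHi) by ring,
      show b₁.psi (b₁.tlo - b₁.epsLo) + ↑(shift hP hBA) - ↑(shift hP hBA) = b₁.psi (b₁.tlo - b₁.epsLo) by ring,
      b₁.psiInv_psi, b₁.psiInv_psi]
    linarith
  obtain ⟨φ, hφs, hφd, hφ1, hφ2⟩ := exists_reparam hl m3 hcond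
  refine ⟨fun θ ↦ φ θ + b₁.tlo, hφs.add contDiff_const, fun θ hθ ↦ ?_, fun θ hθ ↦ ?_, fun θ hθ ↦ ?_⟩
  · rw [deriv_add_const]; exact hφd θ ⟨by linarith [hθ.1], by linarith [hθ.2]⟩
  · show φ θ + b₁.tlo = _
    rw [hl1, hφ1 θ ⟨by linarith [hθ.1], hθ.2⟩]
  · show φ θ + b₁.tlo = _
    rw [hl2, hφ2 θ ⟨hθ.1, by linarith [hθ.2]⟩]; ring

/-- **The reparametrisation** of the band part of `b₁` by the parameter of `A₂`. [folklore] -/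
def phi (hP : IsFlipPair b₁ b₂) (hBA : B₁ = A₂.map (reflectLastDiffeo 3)) : ℝ → ℝ := (exists_phi hP hBA).choose

omit h₁ h₂ in
/-- `φ` is `C^∞`. [folklore] -/
theorem contDiff_phi : ContDiff ℝ ∞ (phi hP hBA) := (exists_phi hP hBA).choose_spec.1

omit h₁ h₂ in
/-- `φ' > 0` on the band part. [folklore] -/
theorem deriv_phi_pos {θ : ℝ} (hθ : θ ∈ Icc (p₁ hP hBA) (p₂ hP hBA)) : 0 < deriv (phi hP hBA) θ :=
  (exists_phi hP hBA).choose_spec.2.1 θ hθ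

omit h₁ h₂ in
/-- `φ` on the upper edge zone. [folklore] -/
theorem phi_of_left {θ : ℝ} (hθ : θ ∈ Icc (p₁ hP hBA) (p₁' hP hBA)) : phi hP hBA θ = b₁.psiInv (θ - shift hP hBA + 1) :=
  (exists_phi hP hBA).choose_spec.2.2.1 θ hθ

omit h₁ h₂ in
/-- `φ` on the lower edge zone. [folklore] -/
theorem phi_of_right {θ : ℝ} (hθ : θ ∈ Icc (p₂' hP hBA) (p₂ hP hBA)) : phi hP hBA θ = b₁.psiInv (θ - shift hP hBA) + 1 :=
  (exists_phi hP hBA).choose_spec.2.2.2 θ hθ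

omit h₁ h₂ in
/-- Values of `φ` at the four marks. [folklore] -/
theorem phi_marks : phi hP hBA (p₁ hP hBA) = b₁.thi + b₁.epsHi / 2 ∧ phi hP hBA (p₁' hP hBA) = b₁.thi + b₁.epsHi ∧
    phi hP hBA (p₂' hP hBA) = b₁.tlo + 1 - b₁.epsLo ∧ phi hP hBA (p₂ hP hBA) = b₁.tlo + 1 - b₁.epsLo / 2 := by
  obtain ⟨m1, m2, m3, m4, m5, -⟩ := marks_A hP hBA
  refine ⟨?_, ?_, ?_, ?_⟩
  · rw [phi_of_left hP hBA ⟨le_rfl, m2.le⟩, p₁, show b₁.psi (b₁.thi + b₁.epsHi / 2) - 1 + ↑(shift hP hBA) - ↑(shift hP hBA) + 1 =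
      b₁.psi (b₁.thi + b₁.epsHi / 2) by ring, psiInv_psi]
  · rw [phi_of_left hP hBA ⟨m2.le, le_rfl⟩, p₁', show b₁.psi (b₁.thi + b₁.epsHi) - 1 + ↑(shift hP hBA) - ↑(shift hP hBA) + 1 =
      b₁.psi (b₁.thi + b₁.epsHi) by ring, psiInv_psi]
  · rw [phi_of_right hP hBA ⟨le_rfl, m4.le⟩, p₂', add_sub_cancel_right, psiInv_psi]; ring
  · rw [phi_of_right hP hBA ⟨m4.le, le_rfl⟩, p₂, add_sub_cancel_right, psiInv_psi]; ring

omit h₁ h₂ in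
/-- `φ` is strictly increasing on the band part. [folklore] -/
theorem strictMonoOn_phi : StrictMonoOn (phi hP hBA) (Icc (p₁ hP hBA) (p₂ hP hBA)) :=
  strictMonoOn_of_deriv_pos (convex_Icc _ _) (contDiff_phi hP hBA).continuous.continuousOn fun _ hθ ↦
    deriv_phi_pos hP hBA (interior_subset hθ)

omit h₁ h₂ in
/-- `φ` maps the band part of `A₂` into the band part of `b₁`. [folklore] -/
theorem phi_mem {θ : ℝ} (hθ : θ ∈ Icc (p₁ hP hBA) (p₂ hP hBA)) :
    phi hP hBA θ ∈ Icc (b₁.thi + b₁.epsHi / 2) (b₁.tlo + 1 - b₁.epsLo / 2) := by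
  obtain ⟨v1, -, -, v4⟩ := phi_marks hP hBA
  obtain ⟨m1, m2, m3, m4, m5, -⟩ := marks_A hP hBA
  have hmono := (strictMonoOn_phi hP hBA).monotoneOn
  have h12 : p₁ hP hBA ≤ p₂ hP hBA := by linarith
  exact ⟨v1 ▸ hmono ⟨le_rfl, h12⟩ hθ hθ.1, v4 ▸ hmono hθ ⟨h12, le_rfl⟩ hθ.2⟩

omit h₁ h₂ in
/-- Inside `(p₁', p₂')`, `φ` is inside `(thi₁ + epsHi, tlo₁ + 1 - epsLo)`. [folklore] -/
theorem phi_mem_Ioo {θ : ℝ} (hθ : θ ∈ Ioo (p₁' hP hBA) (p₂' hP hBA)) :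
    phi hP hBA θ ∈ Ioo (b₁.thi + b₁.epsHi) (b₁.tlo + 1 - b₁.epsLo) := by
  obtain ⟨-, v2, v3, -⟩ := phi_marks hP hBA
  obtain ⟨m1, m2, m3, m4, m5, -⟩ := marks_A hP hBA
  have hmono := strictMonoOn_phi hP hBA
  exact ⟨v2 ▸ hmono ⟨m2.le, by linarith⟩ ⟨by linarith [hθ.1], by linarith [hθ.2]⟩ hθ.1,
    v3 ▸ hmono ⟨by linarith [hθ.1], by linarith [hθ.2]⟩ ⟨by linarith, m4.le⟩ hθ.2⟩

omit h₁ h₂ in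
/-- Left of `p₁'`, `φ ≤ thi₁ + epsHi`; right of `p₂'`, `φ ≥ tlo₁ + 1 - epsLo`. [folklore] -/
theorem phi_le_of_le {θ : ℝ} (hθ : θ ∈ Icc (p₁ hP hBA) (p₂ hP hBA)) :
    (θ ≤ p₁' hP hBA → phi hP hBA θ ≤ b₁.thi + b₁.epsHi) ∧ (p₂' hP hBA ≤ θ → b₁.tlo + 1 - b₁.epsLo ≤ phi hP hBA θ) := by
  obtain ⟨-, v2, v3, -⟩ := phi_marks hP hBA
  obtain ⟨m1, m2, m3, m4, m5, -⟩ := marks_A hP hBA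
  have hmono := (strictMonoOn_phi hP hBA).monotoneOn
  exact ⟨fun h ↦ v2 ▸ hmono hθ ⟨m2.le, by linarith⟩ h, fun h ↦ v3 ▸ hmono ⟨by linarith, m4.le⟩ hθ h⟩

/-! ### The planar loop in the square of `b₂` -/

/-- **The planar loop of `b₂`**: the reflected end loop of the cleaning family, reparametrised. [folklore] -/
def edgeP (θ : ℝ) : 𝔼 2 := pt2 1 1 - cleanP h₁ h₂ 1 (phi hP hBA θ)

/-- The planar loop is `C^∞`. [folklore] -/
theorem contDiff_edgeP : ContDiff ℝ ∞ (edgeP h₁ h₂ hP hBA) :=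
  contDiff_const.sub ((contDiff_cleanP h₁ h₂).comp (contDiff_const.prodMk (contDiff_phi hP hBA)))

/-- First coordinate of the planar loop. [folklore] -/
theorem edgeP_apply_zero (θ : ℝ) : edgeP h₁ h₂ hP hBA θ 0 = 1 - cleanQ h₁ h₂ (phi hP hBA θ) 0 := by
  simp [edgeP, cleanP]

/-- Second coordinate of the planar loop. [folklore] -/
theorem edgeP_apply_one (θ : ℝ) : edgeP h₁ h₂ hP hBA θ 1 = 1 - cleanH h₁ h₂ (phi hP hBA θ) := by
  simp [edgeP, cleanP]

/-- **The band of `b₂` on the planar loop is the reflected band of `b₁` on the end loop.** [folklore] -/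
theorem band_edgeP (θ : ℝ) : b₂.band (edgeP h₁ h₂ hP hBA θ) = reflectLast 3 (b₁.band (cleanP h₁ h₂ 1 (phi hP hBA θ))) := by
  rw [edgeP, hP.symm.band_eq, sub_sub_cancel]

variable {hP' : IsFlipPair b₁ b₂} (hT : PairScale hP' hcross₂ hcross₁ κ)

/-- **On the band part the band of `b₂` on the planar loop is the reflected clean knot.** [folklore] -/
theorem band_edgeP_eq_cleanKnot (hA₁ : A₁.InNorth) (hB₁ : B₁.InSouth) (hAB₁ : Disjoint (range A₁) (range B₁)) (hB₂ : B₂.InSouth)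
    {θ : ℝ} (hθ : θ ∈ Icc (p₁ hP hBA) (p₂ hP hBA)) :
    b₂.band (edgeP h₁ h₂ hP hBA θ) = reflectLast 3 (cleanKnot h₁ h₂ hT hA₁ hB₁ hAB₁ hB₂ (circlePt (phi hP hBA θ))) := by
  rw [band_edgeP, cleanKnot_circlePt_of_mem h₁ h₂ hT hA₁ hB₁ hAB₁ hB₂ (phi_mem hP hBA hθ)]

/-- **On the two edge zones the planar loop is the left edge of `b₂` at the height of `A₂`.** [folklore] -/
theorem edgeP_edge {θ : ℝ} (hθ : θ ∈ Icc (p₁ hP hBA) (p₂ hP hBA)) (hθ' : θ ∉ Ioo (p₁' hP hBA) (p₂' hP hBA)) :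
    edgeP h₁ h₂ hP hBA θ = pt2 0 (b₂.heightA θ) := by
  obtain ⟨m1, m2, m3, m4, m5, m6, m7⟩ := marks_A hP hBA
  obtain ⟨u1, u2⟩ := b₁.thi_marksB
  obtain ⟨l1, l2⟩ := b₁.tlo_marksB
  have hε := b₁.epsLo_bounds.1
  have hε' := b₁.epsHi_bounds.1
  have hw : θ ∈ Icc (b₂.thetaA 10⁻¹) (b₂.thetaA (9 / 10)) := ⟨by linarith [hθ.1], by linarith [hθ.2]⟩
  rw [heightA_eq hP hBA hw]
  rw [mem_Ioo, not_and_or, not_lt, not_lt] at hθ'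
  rcases hθ' with h | h
  · -- upper edge zone
    have hφ := phi_of_left hP hBA ⟨hθ.1, h⟩
    have hle := (phi_le_of_le hP hBA hθ).1 h
    have hge := (phi_mem hP hBA hθ).1
    have hg : b₁.gUp (phi hP hBA θ) = b₁.heightB (θ - shift hP hBA) := by
      rw [b₁.gUp_spec.2.1 _ ⟨by linarith, by linarith⟩, hφ, psi_psiInv, add_sub_cancel_right]
    rw [edgeP, cleanP_of_le_edge h₁ h₂ 1 hle, hg]
    ext i; fin_cases i <;> simp
  · -- lower edge zone
    have hφ := phi_of_right hP hBA ⟨h, hθ.2⟩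
    have hge := (phi_le_of_le hP hBA hθ).2 h
    have hle := (phi_mem hP hBA hθ).2
    have hg : b₁.gLo (phi hP hBA θ - 1) = b₁.heightB (θ - shift hP hBA) := by
      rw [b₁.gLo_spec.2.1 _ ⟨by linarith, by linarith⟩, hφ, add_sub_cancel_right, psi_psiInv]
    rw [edgeP, cleanP_of_ge_edge h₁ h₂ 1 hge, hg]
    ext i; fin_cases i <;> simp

/-- **On the two edge zones the band of `b₂` on the planar loop is `A₂`.** [folklore] -/
theorem band_edgeP_eq_A {θ : ℝ} (hθ : θ ∈ Icc (p₁ hP hBA) (p₂ hP hBA)) (hθ' : θ ∉ Ioo (p₁' hP hBA) (p₂' hP hBA)) :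
    b₂.band (edgeP h₁ h₂ hP hBA θ) = A₂ (circlePt θ) := by
  obtain ⟨m1, m2, m3, m4, m5, -⟩ := marks_A hP hBA
  rw [edgeP_edge h₁ h₂ hP hBA hθ hθ', b₂.band_pt2_zero_heightA ⟨by linarith [hθ.1], by linarith [hθ.2]⟩]

end Edge

section EdgeKnot

variable {A₁ B₁ K₁ : Knot} {b₁ : BandData A₁ B₁ K₁ ∅} {A₂ B₂ K₂ : Knot} {b₂ : BandData A₂ B₂ K₂ ∅}
  {hcross₁ : b₁.band ⁻¹' sphereEquator 2 ∩ squareNhd b₁.δ = {x ∈ squareNhd b₁.δ | x 0 = 2⁻¹}}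
  {hcross₂ : b₂.band ⁻¹' sphereEquator 2 ∩ squareNhd b₂.δ = {x ∈ squareNhd b₂.δ | x 0 = 2⁻¹}}
  {σ₁ ε₁ r₁ A₁' κ ε₂ r₂ : ℝ} (h₁ : b₁.SpikeScale hcross₁ σ₁ ε₁ r₁ A₁' κ) (h₂ : b₂.ArcScale hcross₂ ε₂ r₂ κ)
  (hP : IsFlipPair b₁ b₂) (hBA : B₁ = A₂.map (reflectLastDiffeo 3))

/-! ### The first coordinate of the track is positive -/

/-- **The first coordinate of the track is positive.** [folklore] -/
theorem cleanQ_zero_pos (σ : ℝ) : 0 < cleanQ h₁ h₂ σ 0 := by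
  have hκ := h₁.κ_pos
  have hκ12 := h₁.κ_le
  rcases le_or_gt σ (b₁.parHi hκ h₁.seven_le_gapHi neg_one_mem) with h1 | h1
  · rcases le_or_gt σ (b₁.thi + b₁.epsHi) with h1' | h1'
    · rw [cleanQ_of_le_edge h₁ h₂ h1']; show (0 : ℝ) < 1; norm_num
    · obtain ⟨e, hm⟩ := cleanP_zero_of_zone2 h₁ h₂ 1 ⟨h1', h1⟩
      rw [cleanP_apply_zero] at e; rw [e]; linarith [hm.1]
  rcases lt_or_ge σ (b₁.parLo hκ h₁.seven_le_gapLo neg_one_mem + 1) with h2 | h2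
  · have hb := cleanQ_foreign_bounds h₁ h₂ ⟨h1, h2⟩; linarith [hb.2.1]
  rcases lt_or_ge σ (b₁.tlo + 1 - b₁.epsLo) with h3 | h3
  · obtain ⟨e, hm⟩ := cleanP_zero_of_zone4 h₁ h₂ 1 ⟨h2, h3⟩
    rw [cleanP_apply_zero] at e; rw [e]; linarith [hm.1]
  · rw [cleanQ_of_ge_edge h₁ h₂ h3]; show (0 : ℝ) < 1; norm_num

/-- **The first coordinate of the track is `< 1` strictly inside** `(thi₁ + epsHi, tlo₁ + 1 - epsLo)`.
[folklore] -/
theorem cleanQ_zero_lt_one {σ : ℝ} (hσ : σ ∈ Ioo (b₁.thi + b₁.epsHi) (b₁.tlo + 1 - b₁.epsLo)) : cleanQ h₁ h₂ σ 0 < 1 := by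
  have hκ := h₁.κ_pos
  rcases le_or_gt σ (b₁.parHi hκ h₁.seven_le_gapHi neg_one_mem) with h1 | h1
  · obtain ⟨e, hm⟩ := cleanP_zero_of_zone2 h₁ h₂ 1 ⟨hσ.1, h1⟩
    rw [cleanP_apply_zero] at e; rw [e]; exact hm.2
  rcases lt_or_ge σ (b₁.parLo hκ h₁.seven_le_gapLo neg_one_mem + 1) with h2 | h2
  · have hb := cleanQ_foreign_bounds h₁ h₂ ⟨h1, h2⟩; linarith [hb.1]
  · obtain ⟨e, hm⟩ := cleanP_zero_of_zone4 h₁ h₂ 1 ⟨h2, hσ.2⟩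
    rw [cleanP_apply_zero] at e; rw [e]; exact hm.2

/-- **When the band of `b₁` on the end loop meets `B₁`**: only on the edge zones, at the parameter
`psi₁ σ` (upper) or `psi₁ (σ - 1)` (lower) of `B₁`, modulo one. [folklore] -/
theorem band_cleanP_one_eq_B {σ : ℝ} (hσ : σ ∈ Icc (b₁.thi + b₁.epsHi / 2) (b₁.tlo + 1 - b₁.epsLo / 2)) {v : ℝ}
    (he : b₁.band (cleanP h₁ h₂ 1 σ) = B₁ (circlePt v)) :
    (σ ≤ b₁.thi + b₁.epsHi ∧ circlePt (b₁.psi σ) = circlePt v) ∨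
      (b₁.tlo + 1 - b₁.epsLo ≤ σ ∧ circlePt (b₁.psi (σ - 1)) = circlePt v) := by
  have hκ := h₁.κ_pos
  have hε := b₁.epsLo_bounds.1
  have hε' := b₁.epsHi_bounds.1
  have hm := b₁.marks_lt
  obtain ⟨u1, u2⟩ := b₁.thi_marksB
  obtain ⟨l1, l2⟩ := b₁.tlo_marksB
  have hmem : cleanP h₁ h₂ 1 σ ∈ b₁.band ⁻¹' range B₁ ∩ squareNhd b₁.δ :=
    ⟨⟨circlePt v, he.symm⟩, cleanP_mem h₁ h₂ ⟨zero_le_one, le_rfl⟩ ⟨by linarith [hσ.1], by linarith [hσ.2]⟩⟩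
  rw [b₁.preimage_right] at hmem
  have hx1 : cleanP h₁ h₂ 1 σ 0 = 1 := hmem.2
  rcases le_or_gt σ (b₁.thi + b₁.epsHi) with h1 | h1
  · left
    refine ⟨h1, B₁.injective ?_⟩
    rw [← b₁.band_railUp_eq_B ⟨by linarith [hσ.1], h1⟩, ← he, cleanP_of_le_edge h₁ h₂ 1 h1, b₁.railUp_eq_right h1]
  rcases le_or_gt σ (b₁.parHi hκ h₁.seven_le_gapHi neg_one_mem) with h2 | h2
  · obtain ⟨e, hmm⟩ := cleanP_zero_of_zone2 h₁ h₂ 1 ⟨h1, h2⟩; linarith [hmm.2]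
  rcases lt_or_ge σ (b₁.parLo hκ h₁.seven_le_gapLo neg_one_mem + 1) with h3 | h3
  · obtain ⟨e, hlt⟩ := cleanP_of_zone3 h₁ h₂ 1 ⟨h2, h3⟩
    rw [e] at hx1; linarith
  rcases lt_or_ge σ (b₁.tlo + 1 - b₁.epsLo) with h4 | h4
  · obtain ⟨e, hmm⟩ := cleanP_zero_of_zone4 h₁ h₂ 1 ⟨h3, h4⟩; linarith [hmm.2]
  · right
    refine ⟨h4, B₁.injective ?_⟩
    rw [← b₁.band_railLo_eq_B ⟨by linarith, by linarith [hσ.2]⟩, ← he, cleanP_of_ge_edge h₁ h₂ 1 h4, b₁.railLo_eq_right (by linarith)]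

/-! ### The modified loop of `A₂` and its knot -/

/-- **The piece function of the edge loop**: the band of `b₂` on the planar loop over `(p₁, p₂)`, the
curve of `A₂` elsewhere. [folklore] -/
def edgeF (θ : ℝ) : 𝔼 4 :=
  if p₁ hP hBA < θ ∧ θ < p₂ hP hBA then ((b₂.band (edgeP h₁ h₂ hP hBA θ) : 𝕊 3) : 𝔼 4) else Knot.curve A₂ θ

/-- The piece function inside `(p₁, p₂)`. [folklore] -/
theorem edgeF_of_mem {θ : ℝ} (hθ : θ ∈ Ioo (p₁ hP hBA) (p₂ hP hBA)) :
    edgeF h₁ h₂ hP hBA θ = ((b₂.band (edgeP h₁ h₂ hP hBA θ) : 𝕊 3) : 𝔼 4) := by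
  rw [edgeF, if_pos ⟨hθ.1, hθ.2⟩]

/-- The piece function outside `(p₁, p₂)`. [folklore] -/
theorem edgeF_of_not_mem {θ : ℝ} (hθ : θ ∉ Ioo (p₁ hP hBA) (p₂ hP hBA)) : edgeF h₁ h₂ hP hBA θ = Knot.curve A₂ θ := by
  rw [edgeF, if_neg (fun h ↦ hθ ⟨h.1, h.2⟩)]

/-- **On `[p₁, p₂]` the piece function is the band of `b₂` on the planar loop.** [folklore] -/
theorem edgeF_eq_band {θ : ℝ} (hθ : θ ∈ Icc (p₁ hP hBA) (p₂ hP hBA)) :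
    edgeF h₁ h₂ hP hBA θ = ((b₂.band (edgeP h₁ h₂ hP hBA θ) : 𝕊 3) : 𝔼 4) := by
  by_cases h : θ ∈ Ioo (p₁ hP hBA) (p₂ hP hBA)
  · exact edgeF_of_mem h₁ h₂ hP hBA h
  · obtain ⟨m1, m2, m3, m4, m5, -⟩ := marks_A hP hBA
    have hθ' : θ ∉ Ioo (p₁' hP hBA) (p₂' hP hBA) := fun h' ↦ h ⟨by linarith [h'.1], by linarith [h'.2]⟩
    rw [edgeF_of_not_mem h₁ h₂ hP hBA h, Knot.curve_apply, band_edgeP_eq_A h₁ h₂ hP hBA hθ hθ']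

/-- **Outside `(p₁', p₂')` the piece function is the curve of `A₂`.** [folklore] -/
theorem edgeF_eq_A {θ : ℝ} (hθ : θ ∉ Ioo (p₁' hP hBA) (p₂' hP hBA)) : edgeF h₁ h₂ hP hBA θ = Knot.curve A₂ θ := by
  by_cases h : θ ∈ Ioo (p₁ hP hBA) (p₂ hP hBA)
  · rw [edgeF_of_mem h₁ h₂ hP hBA h, Knot.curve_apply, band_edgeP_eq_A h₁ h₂ hP hBA (Ioo_subset_Icc_self h) hθ]
  · exact edgeF_of_not_mem h₁ h₂ hP hBA h

/-- Near a point outside `(p₁, p₂)` the piece function is the curve of `A₂`. [folklore] -/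
theorem edgeF_eventuallyEq_A {θ : ℝ} (hθ : θ ∉ Ioo (p₁ hP hBA) (p₂ hP hBA)) : edgeF h₁ h₂ hP hBA =ᶠ[𝓝 θ] Knot.curve A₂ := by
  obtain ⟨m1, m2, m3, m4, m5, -⟩ := marks_A hP hBA
  rw [mem_Ioo, not_and_or, not_lt, not_lt] at hθ
  rcases hθ with h | h
  · filter_upwards [Iio_mem_nhds (show θ < p₁' hP hBA by linarith)] with t ht
    exact edgeF_eq_A h₁ h₂ hP hBA (fun hh ↦ absurd ht (not_lt.2 hh.1.le))
  · filter_upwards [Ioi_mem_nhds (show p₂' hP hBA < θ by linarith)] with t ht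
    exact edgeF_eq_A h₁ h₂ hP hBA (fun hh ↦ absurd ht (not_lt.2 hh.2.le))

/-- Near a point of `(p₁, p₂)` the piece function is the band of `b₂` on the planar loop. [folklore] -/
theorem edgeF_eventuallyEq_band {θ : ℝ} (hθ : θ ∈ Ioo (p₁ hP hBA) (p₂ hP hBA)) :
    edgeF h₁ h₂ hP hBA =ᶠ[𝓝 θ] fun θ ↦ ((b₂.band (edgeP h₁ h₂ hP hBA θ) : 𝕊 3) : 𝔼 4) := by
  filter_upwards [Ioo_mem_nhds hθ.1 hθ.2] with t ht using edgeF_of_mem h₁ h₂ hP hBA ht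

/-- **The piece function is `C^∞`.** [folklore] -/
theorem contDiff_edgeF : ContDiff ℝ ∞ (edgeF h₁ h₂ hP hBA) := by
  have hb : ContDiff ℝ ∞ fun θ ↦ ((b₂.band (edgeP h₁ h₂ hP hBA θ) : 𝕊 3) : 𝔼 4) :=
    b₂.contDiff_coe_band.comp (contDiff_edgeP h₁ h₂ hP hBA)
  refine contDiff_iff_contDiffAt.2 fun θ ↦ ?_
  by_cases h : θ ∈ Ioo (p₁ hP hBA) (p₂ hP hBA)
  · exact hb.contDiffAt.congr_of_eventuallyEq (edgeF_eventuallyEq_band h₁ h₂ hP hBA h)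
  · exact A₂.contDiff_curve.contDiffAt.congr_of_eventuallyEq (edgeF_eventuallyEq_A h₁ h₂ hP hBA h)

/-- **The planar loop is regular on the band part.** [folklore] -/
theorem deriv_edgeP_ne_zero {θ : ℝ} (hθ : θ ∈ Icc (p₁ hP hBA) (p₂ hP hBA)) : deriv (edgeP h₁ h₂ hP hBA) θ ≠ 0 := by
  have hm := b₁.marks_lt
  have hε := b₁.epsLo_bounds.1
  have hε' := b₁.epsHi_bounds.1
  have hφ : HasDerivAt (phi hP hBA) (deriv (phi hP hBA) θ) θ := (((contDiff_phi hP hBA).differentiable (by simp)) θ).hasDerivAt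
  have hC : HasDerivAt (cleanP h₁ h₂ 1) (deriv (cleanP h₁ h₂ 1) (phi hP hBA θ)) (phi hP hBA θ) :=
    (differentiableAt_cleanP h₁ h₂ 1 _).hasDerivAt
  have hcomp : HasDerivAt (fun θ ↦ cleanP h₁ h₂ 1 (phi hP hBA θ)) (deriv (phi hP hBA) θ • deriv (cleanP h₁ h₂ 1) (phi hP hBA θ)) θ :=
    HasDerivAt.scomp (g₁ := cleanP h₁ h₂ 1) (h := phi hP hBA) θ hC hφ
  have hd : HasDerivAt (edgeP h₁ h₂ hP hBA) (0 - deriv (phi hP hBA) θ • deriv (cleanP h₁ h₂ 1) (phi hP hBA θ)) θ :=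
    (hasDerivAt_const θ _).sub hcomp
  rw [hd.deriv, zero_sub, neg_ne_zero]
  have hs := phi_mem hP hBA hθ
  exact smul_ne_zero (deriv_phi_pos hP hBA hθ).ne' (deriv_cleanP_ne_zero h₁ h₂ ⟨zero_le_one, le_rfl⟩ ⟨by linarith [hs.1], by linarith [hs.2]⟩)

/-- **The planar loop stays in the square neighbourhood of `b₂`.** [folklore] -/
theorem edgeP_mem {θ : ℝ} (hθ : θ ∈ Icc (p₁ hP hBA) (p₂ hP hBA)) : edgeP h₁ h₂ hP hBA θ ∈ squareNhd b₂.δ := by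
  have hm := b₁.marks_lt
  have hε := b₁.epsLo_bounds.1
  have hε' := b₁.epsHi_bounds.1
  have hs := phi_mem hP hBA hθ
  exact (hP.sub_mem_squareNhd_iff _).2 (cleanP_mem h₁ h₂ ⟨zero_le_one, le_rfl⟩ ⟨by linarith [hs.1], by linarith [hs.2]⟩)

/-- **The planar loop is injective on the band part.** [folklore] -/
theorem injOn_edgeP : InjOn (edgeP h₁ h₂ hP hBA) (Icc (p₁ hP hBA) (p₂ hP hBA)) := by
  intro s hs t ht hst
  have h1 : cleanP h₁ h₂ 1 (phi hP hBA s) = cleanP h₁ h₂ 1 (phi hP hBA t) := sub_right_injective hst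
  have h2 := injOn_cleanP h₁ h₂ ⟨zero_le_one, le_rfl⟩ (phi_mem hP hBA hs) (phi_mem hP hBA ht) h1
  exact (strictMonoOn_phi hP hBA).injOn hs ht h2

/-- The base of the fundamental domain of `A₂`. [folklore] -/
def baseA (_ : IsFlipPair b₁ b₂) (_ : B₁ = A₂.map (reflectLastDiffeo 3)) : ℝ := b₂.thetaA 10⁻¹

/-- The seam margin. [folklore] -/
def marginA (hP : IsFlipPair b₁ b₂) (hBA : B₁ = A₂.map (reflectLastDiffeo 3)) : ℝ :=
  min (p₁ hP hBA - b₂.thetaA 10⁻¹) (b₂.thetaA 10⁻¹ + 1 - p₂ hP hBA) / 2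

omit h₁ h₂ in
/-- The margin is positive and the band part lies inside the fundamental domain with the margin.
[folklore] -/
theorem marginA_spec : 0 < marginA hP hBA ∧ baseA hP hBA + marginA hP hBA ≤ p₁ hP hBA ∧
    p₂ hP hBA ≤ baseA hP hBA + 1 - marginA hP hBA := by
  obtain ⟨m1, m2, m3, m4, m5, -⟩ := marks_A hP hBA
  have hw := b₂.thetaA_window
  have ha : 0 < p₁ hP hBA - b₂.thetaA 10⁻¹ := by linarith
  have hb : 0 < b₂.thetaA 10⁻¹ + 1 - p₂ hP hBA := by linarith
  have h1 : marginA hP hBA ≤ (p₁ hP hBA - b₂.thetaA 10⁻¹) / 2 := div_le_div_of_nonneg_right (min_le_left _ _) two_pos.le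
  have h2 : marginA hP hBA ≤ (b₂.thetaA 10⁻¹ + 1 - p₂ hP hBA) / 2 := div_le_div_of_nonneg_right (min_le_right _ _) two_pos.le
  refine ⟨div_pos (lt_min ha hb) two_pos, ?_, ?_⟩ <;> simp only [baseA] <;> linarith

variable {hP' : IsFlipPair b₁ b₂} (hT : PairScale hP' hcross₂ hcross₁ κ)

/-- **THE EDGE LOOP IS A REGULAR LOOP.** [folklore] -/
theorem isRegularLoop_edgeF : IsRegularLoop (periodise (baseA hP hBA) (edgeF h₁ h₂ hP hBA)) := by
  obtain ⟨hε, hm1, hm2⟩ := marginA_spec hP hBA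
  have h0 : IsRegularLoop (periodise (baseA hP hBA) (Knot.curve A₂)) := by
    rw [periodise_eq_of_periodic _ A₂.periodic_curve]; exact A₂.isRegularLoop_curve
  refine h0.periodise_of_eqOn_compl (S := Icc (p₁ hP hBA) (p₂ hP hBA)) (contDiff_edgeF h₁ h₂ hP hBA) hε
    (fun t _ ↦ A₂.periodic_curve t) (fun t ht ↦ ⟨by linarith [ht.1], by linarith [ht.2]⟩) isClosed_Icc
    (fun t ht ↦ edgeF_of_not_mem h₁ h₂ hP hBA (fun h ↦ ht (Ioo_subset_Icc_self h))) (fun t ht ↦ ?_) (fun t ht ↦ ?_)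
  · rw [edgeF_eq_band h₁ h₂ hP hBA ht]; exact norm_eq_of_mem_sphere _
  · by_cases h : t ∈ Ioo (p₁ hP hBA) (p₂ hP hBA)
    · rw [(edgeF_eventuallyEq_band h₁ h₂ hP hBA h).deriv_eq]
      exact b₂.deriv_coe_band_comp_ne_zero (((contDiff_edgeP h₁ h₂ hP hBA).differentiable (by simp)) t)
        (edgeP_mem h₁ h₂ hP hBA ht) (deriv_edgeP_ne_zero h₁ h₂ hP hBA ht)
    · rw [(edgeF_eventuallyEq_A h₁ h₂ hP hBA h).deriv_eq]; exact A₂.deriv_curve_ne_zero t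

/-- **THE EDGE LOOP IS SIMPLE** on the fundamental domain. [folklore] -/
theorem injOn_edgeF : InjOn (edgeF h₁ h₂ hP hBA) (Ico (baseA hP hBA) (baseA hP hBA + 1)) := by
  obtain ⟨hε, hm1, hm2⟩ := marginA_spec hP hBA
  obtain ⟨m1, m2, m3, m4, m5, m6, m7⟩ := marks_A hP hBA
  refine injOn_Ico_of_eqOn_compl (S := Icc (p₁ hP hBA) (p₂ hP hBA)) (A₂.injOn_curve_Ico _)
    (fun t ht ↦ edgeF_of_not_mem h₁ h₂ hP hBA (fun h ↦ ht (Ioo_subset_Icc_self h))) (fun s hs t ht hst ↦ ?_) (fun s hs t ht hts he ↦ ?_)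
  · rw [edgeF_eq_band h₁ h₂ hP hBA hs, edgeF_eq_band h₁ h₂ hP hBA ht] at hst
    exact injOn_edgeP h₁ h₂ hP hBA hs ht (b₂.injOn (edgeP_mem h₁ h₂ hP hBA hs) (edgeP_mem h₁ h₂ hP hBA ht) (Subtype.ext hst))
  · -- a band point of `b₁` on the end loop equal to a point of `B₁`
    rw [edgeF_eq_band h₁ h₂ hP hBA hs, Knot.curve_apply, band_edgeP, A₂_apply hBA] at he
    have he' : b₁.band (cleanP h₁ h₂ 1 (phi hP hBA s)) = B₁ (circlePt t) := by
      have := congrArg (reflectLast 3) (Subtype.ext he)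
      rwa [reflectLast_reflectLast, reflectLast_reflectLast] at this
    have hsS : s ∈ Ico (baseA hP hBA) (baseA hP hBA + 1) := ⟨by linarith [hs.1], by linarith [hs.2]⟩
    rcases band_cleanP_one_eq_B h₁ h₂ (phi_mem hP hBA hs) he' with ⟨hle, hc⟩ | ⟨hge, hc⟩
    · -- upper edge zone: `s ≤ p₁'` and `psi (φ s) = s - m + 1`
      have hs1 : s ≤ p₁' hP hBA := by
        by_contra hlt
        have := (strictMonoOn_phi hP hBA) ⟨m2.le, by linarith⟩ hs (not_le.1 hlt)
        rw [(phi_marks hP hBA).2.1] at this; linarith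
      rw [phi_of_left hP hBA ⟨hs.1, hs1⟩, psi_psiInv] at hc
      obtain ⟨n, hn⟩ := circlePt_eq_circlePt_iff.1 hc
      -- `t = s + 1 - m - n`: same point of the fundamental domain
      have heq : t = s + ((1 - shift hP hBA - n : ℤ) : ℝ) := by push_cast; linarith
      have h1 : ((1 - shift hP hBA - n : ℤ) : ℝ) < 1 := by linarith [hsS.1, ht.2]
      have h2 : (-1 : ℝ) < ((1 - shift hP hBA - n : ℤ) : ℝ) := by linarith [hsS.2, ht.1]
      have h1' : (1 - shift hP hBA - n : ℤ) < 1 := by exact_mod_cast h1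
      have h2' : -1 < (1 - shift hP hBA - n : ℤ) := by exact_mod_cast h2
      have h0 : (1 - shift hP hBA - n : ℤ) = 0 := by omega
      rw [h0, Int.cast_zero, add_zero] at heq
      exact hts (heq ▸ hs)
    · have hs2 : p₂' hP hBA ≤ s := by
        by_contra hlt
        have := (strictMonoOn_phi hP hBA) hs ⟨by linarith, m4.le⟩ (not_le.1 hlt)
        rw [(phi_marks hP hBA).2.2.1] at this; linarith
      rw [phi_of_right hP hBA ⟨hs2, hs.2⟩, add_sub_cancel_right, psi_psiInv] at hc
      obtain ⟨n, hn⟩ := circlePt_eq_circlePt_iff.1 hc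
      have heq : t = s + ((-shift hP hBA - n : ℤ) : ℝ) := by push_cast; linarith
      have h1 : ((-shift hP hBA - n : ℤ) : ℝ) < 1 := by linarith [hsS.1, ht.2]
      have h2 : (-1 : ℝ) < ((-shift hP hBA - n : ℤ) : ℝ) := by linarith [hsS.2, ht.1]
      have h1' : (-shift hP hBA - n : ℤ) < 1 := by exact_mod_cast h1
      have h2' : -1 < (-shift hP hBA - n : ℤ) := by exact_mod_cast h2
      have h0 : (-shift hP hBA - n : ℤ) = 0 := by omega
      rw [h0, Int.cast_zero, add_zero] at heq
      exact hts (heq ▸ hs)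

/-- **THE EDGE KNOT**: the knot of the modified loop of `A₂`. [folklore] -/
def edgeKnot : Knot :=
  (isRegularLoop_edgeF h₁ h₂ hP hBA).toKnot (periodise_simple_iff.2 (injOn_edgeF h₁ h₂ hP hBA))

/-- The edge knot through `circlePt t` is the periodised piece function, in `ℝ⁴`. [folklore] -/
theorem coe_edgeKnot_circlePt (t : ℝ) :
    ((edgeKnot h₁ h₂ hP hBA (circlePt t) : 𝕊 3) : 𝔼 4) = periodise (baseA hP hBA) (edgeF h₁ h₂ hP hBA) t :=
  (isRegularLoop_edgeF h₁ h₂ hP hBA).coe_toKnot_circlePt _ t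

/-- **The edge knot off the band part is `A₂`.** [folklore] -/
theorem edgeKnot_circlePt_of_not_mem {t : ℝ} (ht : t ∈ Ico (baseA hP hBA) (baseA hP hBA + 1)) (hts : t ∉ Ioo (p₁ hP hBA) (p₂ hP hBA)) :
    edgeKnot h₁ h₂ hP hBA (circlePt t) = A₂ (circlePt t) := by
  apply Subtype.ext
  rw [coe_edgeKnot_circlePt, periodise_eq_self _ _ ht, edgeF_of_not_mem h₁ h₂ hP hBA hts, Knot.curve_apply]

/-- **The edge knot on the band part is the band of `b₂` on the planar loop.** [folklore] -/
theorem edgeKnot_circlePt_of_mem {s : ℝ} (hs : s ∈ Icc (p₁ hP hBA) (p₂ hP hBA)) :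
    edgeKnot h₁ h₂ hP hBA (circlePt s) = b₂.band (edgeP h₁ h₂ hP hBA s) := by
  obtain ⟨hε, hm1, hm2⟩ := marginA_spec hP hBA
  apply Subtype.ext
  rw [coe_edgeKnot_circlePt, periodise_eq_self _ _ ⟨by linarith [hs.1], by linarith [hs.2]⟩, edgeF_eq_band h₁ h₂ hP hBA hs]

/-! ### The edge knot is an edge loop of `b₂` -/

/-- Derivatives of the coordinates of the planar loop. [folklore] -/
theorem hasDerivAt_edgeP_coord (θ : ℝ) :
    HasDerivAt (fun θ ↦ edgeP h₁ h₂ hP hBA θ 0) (-(deriv (fun σ ↦ cleanQ h₁ h₂ σ 0) (phi hP hBA θ) * deriv (phi hP hBA) θ)) θ ∧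
    HasDerivAt (fun θ ↦ edgeP h₁ h₂ hP hBA θ 1) (-(deriv (cleanH h₁ h₂) (phi hP hBA θ) * deriv (phi hP hBA) θ)) θ := by
  have hφ : HasDerivAt (phi hP hBA) (deriv (phi hP hBA) θ) θ := (((contDiff_phi hP hBA).differentiable (by simp)) θ).hasDerivAt
  have hQ : HasDerivAt (fun σ ↦ cleanQ h₁ h₂ σ 0) (deriv (fun σ ↦ cleanQ h₁ h₂ σ 0) (phi hP hBA θ)) (phi hP hBA θ) :=
    (((contDiff_euclidean.1 (contDiff_cleanQ h₁ h₂) 0).differentiable (by simp)) _).hasDerivAt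
  have hH : HasDerivAt (cleanH h₁ h₂) (deriv (cleanH h₁ h₂) (phi hP hBA θ)) (phi hP hBA θ) :=
    (((contDiff_cleanH h₁ h₂).differentiable (by simp)) _).hasDerivAt
  have e0 : (fun θ ↦ edgeP h₁ h₂ hP hBA θ 0) = fun θ ↦ 1 - cleanQ h₁ h₂ (phi hP hBA θ) 0 := funext fun θ ↦ edgeP_apply_zero h₁ h₂ hP hBA θ
  have e1 : (fun θ ↦ edgeP h₁ h₂ hP hBA θ 1) = fun θ ↦ 1 - cleanH h₁ h₂ (phi hP hBA θ) := funext fun θ ↦ edgeP_apply_one h₁ h₂ hP hBA θ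
  rw [e0, e1]
  exact ⟨(hasDerivAt_const θ (1 : ℝ)).sub (HasDerivAt.comp (h₂ := fun σ ↦ cleanQ h₁ h₂ σ 0) (h := phi hP hBA) θ hQ hφ) |>.congr_deriv (by ring),
    (hasDerivAt_const θ (1 : ℝ)).sub (HasDerivAt.comp (h₂ := cleanH h₁ h₂) (h := phi hP hBA) θ hH hφ) |>.congr_deriv (by ring)⟩

/-- **THE EDGE KNOT IS AN EDGE LOOP OF `b₂`** about the height `1/2`. [folklore] -/
theorem edgeLoop_edgeKnot : b₂.EdgeLoop (edgeKnot h₁ h₂ hP hBA) (edgeP h₁ h₂ hP hBA) (p₁ hP hBA) (p₁' hP hBA) (p₂' hP hBA) (p₂ hP hBA) 2⁻¹ := by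
  obtain ⟨m1, m2, m3, m4, m5, m6, m7⟩ := marks_A hP hBA
  have hκ := h₁.κ_pos
  have hm := b₁.marks_lt
  have hε := b₁.epsLo_bounds.1
  have hε' := b₁.epsHi_bounds.1
  have hcm := b₁.core_marks
  have n1 := (b₁.parHi_mem_core hκ h₁.seven_le_gapHi neg_one_mem).1
  have l1 := (b₁.parLo_mem_core hκ h₁.seven_le_gapLo neg_one_mem).2
  have hw := b₁.tcHi_window
  have hw' := b₁.tcLo_window
  refine ⟨⟨m1, m2, m3, m4, m5⟩, contDiff_edgeP h₁ h₂ hP hBA, fun s hs ↦ ?_, fun t ht hts ↦ edgeKnot_circlePt_of_not_mem h₁ h₂ hP hBA ht hts,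
    fun s hs hs' ↦ edgeP_edge h₁ h₂ hP hBA hs hs', fun s hs ↦ edgeP_mem h₁ h₂ hP hBA hs, fun s hs ↦ ?_, fun s hs ↦ ?_,
    injOn_edgeP h₁ h₂ hP hBA, fun s hs ↦ ?_, fun s hs ↦ ?_, ?_⟩
  · -- curve on the band part
    rw [Knot.curve_apply, edgeKnot_circlePt_of_mem h₁ h₂ hP hBA hs]
  · -- positive first coordinate inside
    rw [edgeP_apply_zero, sub_pos]
    exact cleanQ_zero_lt_one h₁ h₂ (phi_mem_Ioo hP hBA hs)
  · -- first coordinate below one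
    rw [edgeP_apply_zero, sub_lt_self_iff]
    exact cleanQ_zero_pos h₁ h₂ _
  · -- monotone height
    rw [(hasDerivAt_edgeP_coord h₁ h₂ hP hBA s).2.deriv, neg_nonneg]
    exact mul_nonpos_of_nonpos_of_nonneg (cleanH_turn h₁ h₂ (phi_mem hP hBA hs)).1 (deriv_phi_pos hP hBA hs).le
  · -- turning
    rw [(hasDerivAt_edgeP_coord h₁ h₂ hP hBA s).1.deriv, (hasDerivAt_edgeP_coord h₁ h₂ hP hBA s).2.deriv, edgeP_apply_one]
    obtain ⟨-, hT'⟩ := cleanH_turn h₁ h₂ (phi_mem hP hBA hs)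
    have hφ' := deriv_phi_pos hP hBA hs
    set H := cleanH h₁ h₂ (phi hP hBA s)
    set H' := deriv (cleanH h₁ h₂) (phi hP hBA s)
    set Q' := deriv (fun σ ↦ cleanQ h₁ h₂ σ 0) (phi hP hBA s)
    set φ' := deriv (phi hP hBA) s
    have e : (1 - H - 2⁻¹) * -(Q' * φ') - 3 * -(H' * φ') = φ' * ((H - 2⁻¹) * Q' + 3 * H') := by ring
    have : (1 - H - 2⁻¹) * -(Q' * φ') - 3 * -(H' * φ') < 0 := by rw [e]; exact mul_neg_of_pos_of_neg hφ' hT'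
    linarith
  · -- straddle
    obtain ⟨v1, -, -, v4⟩ := phi_marks hP hBA
    have e1 : b₂.heightA (p₁ hP hBA) = edgeP h₁ h₂ hP hBA (p₁ hP hBA) 1 := by
      rw [edgeP_edge h₁ h₂ hP hBA ⟨le_rfl, by linarith⟩ (fun h ↦ by linarith [h.1])]; rfl
    have e2 : b₂.heightA (p₂ hP hBA) = edgeP h₁ h₂ hP hBA (p₂ hP hBA) 1 := by
      rw [edgeP_edge h₁ h₂ hP hBA ⟨by linarith, le_rfl⟩ (fun h ↦ by linarith [h.2])]; rfl
    rw [e1, e2, edgeP_apply_one, edgeP_apply_one, ← cleanP_one_apply_one, ← cleanP_one_apply_one, v1, v4]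
    have hu := (cleanP_one_ge_of_upper h₁ h₂ (u := 1) ⟨zero_le_one, le_rfl⟩ (s := b₁.thi + b₁.epsHi / 2) ⟨by linarith, by linarith⟩).1
    have hl := (cleanP_one_le_of_lower h₁ h₂ (u := 1) ⟨zero_le_one, le_rfl⟩ (s := b₁.tlo + 1 - b₁.epsLo / 2) ⟨by linarith, by linarith⟩).1
    constructor <;> linarith

/-- **THE EDGE KNOT IS ISOTOPIC TO `A₂`.** [cite: HirschDT1976, Ch. 8 §1, Thm. 1.3] -/
theorem isIsotopic_edgeKnot_A : (edgeKnot h₁ h₂ hP hBA).IsIsotopic A₂ :=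
  (edgeLoop_edgeKnot h₁ h₂ hP hBA).isIsotopic

end EdgeKnot

section Final

variable {A₁ B₁ K₁ : Knot} {b₁ : BandData A₁ B₁ K₁ ∅} {A₂ B₂ K₂ : Knot} {b₂ : BandData A₂ B₂ K₂ ∅}
  {hcross₁ : b₁.band ⁻¹' sphereEquator 2 ∩ squareNhd b₁.δ = {x ∈ squareNhd b₁.δ | x 0 = 2⁻¹}}
  {hcross₂ : b₂.band ⁻¹' sphereEquator 2 ∩ squareNhd b₂.δ = {x ∈ squareNhd b₂.δ | x 0 = 2⁻¹}}
  {σ₁ ε₁ r₁ A₁' κ ε₂ r₂ : ℝ} (h₁ : b₁.SpikeScale hcross₁ σ₁ ε₁ r₁ A₁' κ) (h₂ : b₂.ArcScale hcross₂ ε₂ r₂ κ)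
  (hP : IsFlipPair b₁ b₂) (hBA : B₁ = A₂.map (reflectLastDiffeo 3)) (hT : PairScale hP hcross₂ hcross₁ κ)
  (hA₁ : A₁.InNorth) (hB₁ : B₁.InSouth) (hAB₁ : Disjoint (range A₁) (range B₁)) (hB₂ : B₂.InSouth)

/-! ### The clean knot off the band part: points of `B₁` in a window -/

/-- **Off the band part the clean knot is a point of `B₁`** with parameter in the window
`(psi₁ (tlo₁ - epsLo/2), psi₁ (thi₁ + epsHi/2))`. [folklore] -/
theorem cleanKnot_eq_B_of_not_mem {u : ℝ} (hu : u ∈ Ico b₁.tlo (b₁.tlo + 1))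
    (hus : u ∉ Icc (b₁.thi + b₁.epsHi / 2) (b₁.tlo + 1 - b₁.epsLo / 2)) :
    ∃ v ∈ Ioo (b₁.psi (b₁.tlo - b₁.epsLo / 2)) (b₁.psi (b₁.thi + b₁.epsHi / 2)),
      cleanKnot h₁ h₂ hT hA₁ hB₁ hAB₁ hB₂ (circlePt u) = B₁ (circlePt v) := by
  have hm := b₁.marks_lt
  have hε := b₁.epsLo_bounds.1
  have hε' := b₁.epsHi_bounds.1
  have hmono := b₁.strictMono_psi
  rw [mem_Icc, not_and_or, not_le, not_le] at hus
  rcases hus with h | h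
  · refine ⟨b₁.psi u, ⟨hmono (by linarith [hu.1]), hmono h⟩, cleanKnot_circlePt_eq_B h₁ h₂ hT hA₁ hB₁ hAB₁ hB₂ ⟨hu.1, h⟩⟩
  · refine ⟨b₁.psi (u - 1), ⟨hmono (by linarith), hmono (by linarith [hu.2])⟩, ?_⟩
    rw [cleanKnot_circlePt_of_not_mem h₁ h₂ hT hA₁ hB₁ hAB₁ hB₂ hu (fun hh ↦ by linarith [hh.2]),
      show circlePt u = circlePt (u - 1) by conv_lhs => rw [show u = u - 1 + 1 by ring, circlePt_add_one],
      frameKnotZero_circlePt_eq_B h₁ h₂ hT hA₁ hB₁ hAB₁ hB₂ ⟨by linarith [hu.2], by linarith [hu.2]⟩]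

/-- **Every point of `B₁` in the window is a point of the clean knot off the band part.** [folklore] -/
theorem B_eq_cleanKnot {v : ℝ} (hv : v ∈ Ioo (b₁.psi (b₁.tlo - b₁.epsLo / 2)) (b₁.psi (b₁.thi + b₁.epsHi / 2))) :
    ∃ u ∈ Ico b₁.tlo (b₁.tlo + 1), u ∉ Icc (b₁.thi + b₁.epsHi / 2) (b₁.tlo + 1 - b₁.epsLo / 2) ∧
      cleanKnot h₁ h₂ hT hA₁ hB₁ hAB₁ hB₂ (circlePt u) = B₁ (circlePt v) := by
  have hm := b₁.marks_lt
  obtain ⟨hε, hε5', -⟩ := b₁.epsLo_bounds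
  obtain ⟨hε', hε5, -⟩ := b₁.epsHi_bounds
  have hmono := b₁.strictMono_psiInv
  set u := b₁.psiInv v with hu
  have hv' : b₁.psi u = v := b₁.psi_psiInv v
  have hu1 : b₁.tlo - b₁.epsLo / 2 < u := by have := hmono hv.1; rwa [psiInv_psi] at this
  have hu2 : u < b₁.thi + b₁.epsHi / 2 := by have := hmono hv.2; rwa [psiInv_psi] at this
  rcases lt_or_ge u b₁.tlo with h | h
  · refine ⟨u + 1, ⟨by linarith, by linarith⟩, fun hh ↦ by linarith [hh.2], ?_⟩
    rw [cleanKnot_circlePt_of_not_mem h₁ h₂ hT hA₁ hB₁ hAB₁ hB₂ ⟨by linarith, by linarith⟩ (fun hh ↦ by linarith [hh.2]),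
      circlePt_add_one, frameKnotZero_circlePt_eq_B h₁ h₂ hT hA₁ hB₁ hAB₁ hB₂ ⟨by linarith, by linarith⟩, hv']
  · refine ⟨u, ⟨h, by linarith⟩, fun hh ↦ by linarith [hh.1], ?_⟩
    rw [cleanKnot_circlePt_eq_B h₁ h₂ hT hA₁ hB₁ hAB₁ hB₂ ⟨h, hu2⟩, hv']

omit h₁ h₂ in
/-- The window of `B₁` in terms of the marks of `A₂`: `(p₂ - m, p₁ + 1 - m)`. [folklore] -/
theorem window_eq : b₁.psi (b₁.tlo - b₁.epsLo / 2) = p₂ hP hBA - shift hP hBA ∧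
    b₁.psi (b₁.thi + b₁.epsHi / 2) = p₁ hP hBA + 1 - shift hP hBA := by
  simp only [p₁, p₂]; constructor <;> ring

/-- **The edge knot on the window `(p₂, p₁ + 1)` is `A₂`** (the window avoids the band part modulo
one). [folklore] -/
theorem edgeKnot_circlePt_eq_A {t : ℝ} (ht : t ∈ Ioo (p₂ hP hBA) (p₁ hP hBA + 1)) :
    edgeKnot h₁ h₂ hP hBA (circlePt t) = A₂ (circlePt t) := by
  obtain ⟨m1, m2, m3, m4, m5, -⟩ := marks_A hP hBA
  have hw := b₂.thetaA_window
  rcases lt_or_ge t (baseA hP hBA + 1) with h | h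
  · exact edgeKnot_circlePt_of_not_mem h₁ h₂ hP hBA ⟨by simp only [baseA]; linarith [ht.1], h⟩ (fun hh ↦ by linarith [hh.2, ht.1])
  · have e : circlePt t = circlePt (t - 1) := by conv_lhs => rw [show t = t - 1 + 1 by ring, circlePt_add_one]
    rw [e, edgeKnot_circlePt_of_not_mem h₁ h₂ hP hBA ⟨by linarith, by simp only [baseA] at h ⊢; linarith [ht.2]⟩
      (fun hh ↦ by linarith [hh.1, ht.2])]

/-- **A parameter of the fundamental domain of `A₂` off the band part is in the window modulo one.**
[folklore] -/
theorem exists_window_of_not_mem {t : ℝ} (ht : t ∈ Ico (baseA hP hBA) (baseA hP hBA + 1)) (hts : t ∉ Icc (p₁ hP hBA) (p₂ hP hBA)) :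
    ∃ v ∈ Ioo (b₁.psi (b₁.tlo - b₁.epsLo / 2)) (b₁.psi (b₁.thi + b₁.epsHi / 2)), circlePt t = circlePt v := by
  obtain ⟨w1, w2⟩ := window_eq hP hBA
  obtain ⟨m1, m2, m3, m4, m5, -⟩ := marks_A hP hBA
  obtain ⟨e1, e2⟩ := thetaA_ends hP hBA
  have hw := b₁.thetaB_window
  have hw2 := b₂.thetaA_window
  have t1 : b₁.thetaB (9 / 10) < b₁.thetaB (4 / 5) := b₁.strictAntiOn_thetaB (by norm_num) (by norm_num) (by norm_num)
  simp only [baseA] at ht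
  rw [mem_Icc, not_and_or, not_le, not_le] at hts
  rw [w1, w2]
  rcases hts with h | h
  · refine ⟨t + 1 - shift hP hBA, ⟨by linarith [ht.1], by linarith⟩, ?_⟩
    rw [show t + 1 - (shift hP hBA : ℝ) = t + ((1 - shift hP hBA : ℤ) : ℝ) by push_cast; ring, circlePt_add_int]
  · refine ⟨t - shift hP hBA, ⟨by linarith, by linarith [ht.2]⟩, ?_⟩
    rw [show t - (shift hP hBA : ℝ) = t + ((-shift hP hBA : ℤ) : ℝ) by push_cast; ring, circlePt_add_int]

/-- **THE EDGE KNOT AND THE REFLECTED CLEAN KNOT HAVE THE SAME RANGE.** [folklore] -/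
theorem range_edgeKnot :
    range (edgeKnot h₁ h₂ hP hBA) = range ((cleanKnot h₁ h₂ hT hA₁ hB₁ hAB₁ hB₂).map (reflectLastDiffeo 3)) := by
  obtain ⟨w1, w2⟩ := window_eq hP hBA
  obtain ⟨m1, m2, m3, m4, m5, -⟩ := marks_A hP hBA
  obtain ⟨v1, -, -, v4⟩ := phi_marks hP hBA
  have hw := b₂.thetaA_window
  apply Subset.antisymm
  · rintro x ⟨y, rfl⟩
    obtain ⟨t, ht, rfl⟩ := exists_circlePt_eq_of_Ico (baseA hP hBA) y
    by_cases hts : t ∈ Icc (p₁ hP hBA) (p₂ hP hBA)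
    · refine ⟨circlePt (phi hP hBA t), ?_⟩
      rw [SphereEmbedding.map_apply, coe_reflectLastDiffeo, edgeKnot_circlePt_of_mem h₁ h₂ hP hBA hts,
        band_edgeP_eq_cleanKnot h₁ h₂ hP hBA hT hA₁ hB₁ hAB₁ hB₂ hts]
    · obtain ⟨v, hv, hev⟩ := exists_window_of_not_mem hP hBA ht hts
      obtain ⟨u, -, -, heu⟩ := B_eq_cleanKnot h₁ h₂ hP hT hA₁ hB₁ hAB₁ hB₂ hv
      refine ⟨circlePt u, ?_⟩
      rw [SphereEmbedding.map_apply, coe_reflectLastDiffeo, heu, edgeKnot_circlePt_of_not_mem h₁ h₂ hP hBA ht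
        (fun hh ↦ hts (Ioo_subset_Icc_self hh)), A₂_apply hBA, hev]
  · rintro x ⟨y, rfl⟩
    obtain ⟨u, hu, rfl⟩ := exists_circlePt_eq_of_Ico b₁.tlo y
    rw [SphereEmbedding.map_apply, coe_reflectLastDiffeo]
    by_cases hus : u ∈ Icc (b₁.thi + b₁.epsHi / 2) (b₁.tlo + 1 - b₁.epsLo / 2)
    · -- `u = φ θ`
      have hcont : ContinuousOn (phi hP hBA) (Icc (p₁ hP hBA) (p₂ hP hBA)) := (contDiff_phi hP hBA).continuous.continuousOn
      have hy : u ∈ Icc (phi hP hBA (p₁ hP hBA)) (phi hP hBA (p₂ hP hBA)) := by rw [v1, v4]; exact hus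
      obtain ⟨θ, hθ, hθu⟩ := intermediate_value_Icc (by linarith) hcont hy
      refine ⟨circlePt θ, ?_⟩
      rw [edgeKnot_circlePt_of_mem h₁ h₂ hP hBA hθ, band_edgeP_eq_cleanKnot h₁ h₂ hP hBA hT hA₁ hB₁ hAB₁ hB₂ hθ, hθu]
    · obtain ⟨v, hv, hev⟩ := cleanKnot_eq_B_of_not_mem h₁ h₂ hP hT hA₁ hB₁ hAB₁ hB₂ hu hus
      refine ⟨circlePt (v + shift hP hBA), ?_⟩
      rw [edgeKnot_circlePt_eq_A h₁ h₂ hP hBA ⟨by linarith [hv.1], by linarith [hv.2]⟩, circlePt_add_int, A₂_apply hBA, hev]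

/-- **THE EDGE KNOT AND THE REFLECTED CLEAN KNOT INDUCE THE SAME ORIENTATION.** [folklore] -/
theorem sameOrientationAt_edgeKnot :
    Knot.SameOrientationAt (edgeKnot h₁ h₂ hP hBA) ((cleanKnot h₁ h₂ hT hA₁ hB₁ hAB₁ hB₂).map (reflectLastDiffeo 3)) := by
  obtain ⟨w1, w2⟩ := window_eq hP hBA
  have hm := b₁.marks_lt
  have hε := b₁.epsLo_bounds.1
  have hε' := b₁.epsHi_bounds.1
  have hl := b₁.lam_pos
  have hπ : 0 < 2 * π := by positivity
  -- a parameter of `b₁` strictly between `tlo` and the band part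
  set u₀ := (b₁.tlo + (b₁.thi + b₁.epsHi / 2)) / 2 with hu₀
  have hu₀1 : b₁.tlo < u₀ := by rw [hu₀]; linarith
  have hu₀2 : u₀ < b₁.thi + b₁.epsHi / 2 := by rw [hu₀]; linarith
  set v₀ := b₁.psi u₀ with hv₀
  have hv₀ : v₀ ∈ Ioo (b₁.psi (b₁.tlo - b₁.epsLo / 2)) (b₁.psi (b₁.thi + b₁.epsHi / 2)) :=
    ⟨b₁.strictMono_psi (by linarith), b₁.strictMono_psi hu₀2⟩
  -- the two curves read through the angle
  set f : ℝ → 𝔼 4 := fun θ ↦ ((edgeKnot h₁ h₂ hP hBA (circlePoint θ) : 𝕊 3) : 𝔼 4) with hf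
  set g : ℝ → 𝔼 4 := fun θ ↦ (((cleanKnot h₁ h₂ hT hA₁ hB₁ hAB₁ hB₂).map (reflectLastDiffeo 3) (circlePoint θ) : 𝕊 3) : 𝔼 4) with hg
  -- `f = A₂.curve (θ / 2π)` near `2π (v₀ + m)`
  have hopen1 : IsOpen ((fun θ : ℝ ↦ θ / (2 * π)) ⁻¹' Ioo (p₂ hP hBA) (p₁ hP hBA + 1)) := isOpen_Ioo.preimage (continuous_id.div_const _)
  have hmem1 : 2 * π * (v₀ + shift hP hBA) ∈ (fun θ : ℝ ↦ θ / (2 * π)) ⁻¹' Ioo (p₂ hP hBA) (p₁ hP hBA + 1) := by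
    show 2 * π * (v₀ + shift hP hBA) / (2 * π) ∈ Ioo (p₂ hP hBA) (p₁ hP hBA + 1)
    rw [mul_div_cancel_left₀ _ hπ.ne']; exact ⟨by linarith [hv₀.1], by linarith [hv₀.2]⟩
  have hf_ev : f =ᶠ[𝓝 (2 * π * (v₀ + shift hP hBA))] fun θ ↦ Knot.curve A₂ (θ / (2 * π)) := by
    filter_upwards [hopen1.mem_nhds hmem1] with θ hθ
    have e : circlePoint θ = circlePt (θ / (2 * π)) := by rw [circlePt_eq_circlePoint, mul_div_cancel₀ _ hπ.ne']
    simp only [hf]; rw [e, edgeKnot_circlePt_eq_A h₁ h₂ hP hBA hθ, Knot.curve_apply]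
  -- `g = A₂.curve (psi (θ / 2π))` near `2π u₀`
  have hopen2 : IsOpen ((fun θ : ℝ ↦ θ / (2 * π)) ⁻¹' Ioo b₁.tlo (b₁.thi + b₁.epsHi / 2)) := isOpen_Ioo.preimage (continuous_id.div_const _)
  have hmem2 : 2 * π * u₀ ∈ (fun θ : ℝ ↦ θ / (2 * π)) ⁻¹' Ioo b₁.tlo (b₁.thi + b₁.epsHi / 2) := by
    show 2 * π * u₀ / (2 * π) ∈ Ioo b₁.tlo (b₁.thi + b₁.epsHi / 2)
    rw [mul_div_cancel_left₀ _ hπ.ne']; exact ⟨hu₀1, hu₀2⟩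
  have hg_ev : g =ᶠ[𝓝 (2 * π * u₀)] fun θ ↦ Knot.curve A₂ (b₁.psi (θ / (2 * π))) := by
    filter_upwards [hopen2.mem_nhds hmem2] with θ hθ
    have e : circlePoint θ = circlePt (θ / (2 * π)) := by rw [circlePt_eq_circlePoint, mul_div_cancel₀ _ hπ.ne']
    simp only [hg]
    rw [e, SphereEmbedding.map_apply, coe_reflectLastDiffeo, cleanKnot_circlePt_eq_B h₁ h₂ hT hA₁ hB₁ hAB₁ hB₂ ⟨hθ.1.le, hθ.2⟩,
      ← A₂_apply hBA, Knot.curve_apply]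
  -- the derivatives
  have hA : ∀ s, HasDerivAt (Knot.curve A₂) (deriv (Knot.curve A₂) s) s := fun s ↦ ((A₂.contDiff_curve.differentiable (by simp)) s).hasDerivAt
  have hper : deriv (Knot.curve A₂) (v₀ + shift hP hBA) = deriv (Knot.curve A₂) v₀ := by
    have := (Function.Periodic.deriv A₂.periodic_curve).int_mul (shift hP hBA) v₀
    simpa using this
  have hdiv : ∀ θ, HasDerivAt (fun θ : ℝ ↦ θ / (2 * π)) (1 / (2 * π)) θ := fun θ ↦ by
    simpa using (hasDerivAt_id θ).div_const (2 * π)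
  have hdf : HasDerivAt (fun θ ↦ Knot.curve A₂ (θ / (2 * π))) ((1 / (2 * π)) • deriv (Knot.curve A₂) v₀) (2 * π * (v₀ + shift hP hBA)) := by
    have h := HasDerivAt.scomp (g₁ := Knot.curve A₂) (h := fun θ : ℝ ↦ θ / (2 * π)) (2 * π * (v₀ + shift hP hBA))
      (by rw [mul_div_cancel_left₀ _ hπ.ne']; exact hA _) (hdiv _)
    rwa [hper] at h
  have hpsi : ∀ s, HasDerivAt b₁.psi b₁.lam s := fun s ↦ by
    have h : HasDerivAt (fun x ↦ b₁.thetaB (1 / 5) + (x - b₁.tlo) * b₁.lam) (1 * b₁.lam) s :=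
      (((hasDerivAt_id s).sub_const b₁.tlo).mul_const b₁.lam).const_add _
    rw [one_mul] at h
    exact h
  have hdg : HasDerivAt (fun θ ↦ Knot.curve A₂ (b₁.psi (θ / (2 * π)))) ((b₁.lam * (1 / (2 * π))) • deriv (Knot.curve A₂) v₀) (2 * π * u₀) := by
    have hin : HasDerivAt (fun θ ↦ b₁.psi (θ / (2 * π))) (b₁.lam * (1 / (2 * π))) (2 * π * u₀) :=
      HasDerivAt.comp (h₂ := b₁.psi) (h := fun θ : ℝ ↦ θ / (2 * π)) (2 * π * u₀) (hpsi _) (hdiv _)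
    have h := HasDerivAt.scomp (g₁ := Knot.curve A₂) (h := fun θ ↦ b₁.psi (θ / (2 * π))) (2 * π * u₀)
      (by rw [mul_div_cancel_left₀ _ hπ.ne']; exact hA _) hin
    exact h
  refine ⟨2 * π * (v₀ + shift hP hBA), 2 * π * u₀, 1 / b₁.lam, by positivity, ?_, ?_⟩
  · -- same point
    have e1 : circlePoint (2 * π * (v₀ + shift hP hBA)) = circlePt (v₀ + shift hP hBA) := by rw [circlePt_eq_circlePoint]
    have e2 : circlePoint (2 * π * u₀) = circlePt u₀ := by rw [circlePt_eq_circlePoint]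
    rw [e1, e2, edgeKnot_circlePt_eq_A h₁ h₂ hP hBA ⟨by linarith [hv₀.1], by linarith [hv₀.2]⟩, circlePt_add_int,
      SphereEmbedding.map_apply, coe_reflectLastDiffeo, cleanKnot_circlePt_eq_B h₁ h₂ hT hA₁ hB₁ hAB₁ hB₂ ⟨hu₀1.le, hu₀2⟩, ← A₂_apply hBA]
  · show deriv f (2 * π * (v₀ + shift hP hBA)) = (1 / b₁.lam) • deriv g (2 * π * u₀)
    rw [hf_ev.deriv_eq, hg_ev.deriv_eq, hdf.deriv, hdg.deriv, smul_smul]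
    congr 1
    field_simp

include hBA in
/-- **THE CLEAN KNOT IS ISOTOPIC TO THE SECOND SUMMAND.** [cite: HirschDT1976, Ch. 8 §1, Thm. 1.3] -/
theorem isIsotopic_cleanKnot_B : (cleanKnot h₁ h₂ hT hA₁ hB₁ hAB₁ hB₂).IsIsotopic B₁ := by
  set C := cleanKnot h₁ h₂ hT hA₁ hB₁ hAB₁ hB₂
  set R := reflectLastDiffeo 3
  -- `C.map R ≅ edgeKnot ≅ A₂`
  have h1 : (edgeKnot h₁ h₂ hP hBA).IsIsotopic (C.map R) :=
    Knot.isIsotopic_of_range_eq_holds (range_edgeKnot h₁ h₂ hP hBA hT hA₁ hB₁ hAB₁ hB₂) (sameOrientationAt_edgeKnot h₁ h₂ hP hBA hT hA₁ hB₁ hAB₁ hB₂)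
  have h2 : (C.map R).IsIsotopic A₂ :=
    IsAmbientIsotopic.trans_holds (SphereEmbedding.IsIsotopic.symm_holds h1) (isIsotopic_edgeKnot_A h₁ h₂ hP hBA)
  -- reflect back
  have h3 : ((C.map R).map R).IsIsotopic (A₂.map R) := h2.map_congr R
  have e1 : (C.map R).map R = C := DFunLike.coe_injective (funext fun x ↦ by
    simp only [SphereEmbedding.map_apply, R, coe_reflectLastDiffeo, reflectLast_reflectLast])
  rw [e1, ← hBA] at h3
  exact h3

include hBA in
/-- **THE FRAME KNOT OF THE UN-SPIKED FLIP FRAME IS ISOTOPIC TO THE SECOND SUMMAND.**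
[cite: HirschDT1976, Ch. 8 §1, Thm. 1.3] -/
theorem isIsotopic_frameKnotZero_B : (frameKnotZero h₁ h₂ hT hA₁ hB₁ hAB₁ hB₂).IsIsotopic B₁ :=
  IsAmbientIsotopic.trans_holds (isIsotopic_frameKnotZero_cleanKnot h₁ h₂ hT hA₁ hB₁ hAB₁ hB₂)
    (isIsotopic_cleanKnot_B h₁ h₂ hP hBA hT hA₁ hB₁ hAB₁ hB₂)

end Final

end BandData

end Literature.Topology.FourManifolds
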